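import Mathlib
import Literature.Computability.MetaComplexity.PolynomialCalculus
import HarnessLib

/-!
# Razborov's degree lower bound for PC-refutations of `¬WPHP^m_n` — the proof

Discharge of the named fact `PC.Razborov1998_PC_negWPHP_degree` of `PolynomialCalculus.lean`
(Krajíček 2019, Thm. 16.2.1; originally Razborov 1998): for every field `F` and all
`m > n ≥ 1` there is no PC/F-refutation of the polynomial system `¬WPHP^m_n` of degree `≤ n/2`.
Everything in this file is proved; the final declaration is
`PC.Razborov1998_PC_negWPHP_degree_holds : PC.Razborov1998_PC_negWPHP_degree`.
The proof is the printed one — Krajíček's presentation of Razborov's argument as simplified by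
Impagliazzo, Pudlák and Sgall (Lemma 16.2.2 with Claims 1–3, pp. 333–336) — organised as follows
(everything auxiliary lives in the namespace `PC.RazborovDance`).

## The printed proof and its rendering here

* p. 333: `Ŝ = F[x̄] / (x_{ij}² - x_{ij}, Q_{i₁,i₂;j}, Q_{i;j₁,j₂})` with basis
  `T = {x_α : α ∈ Maps}` (partial injective maps `[m] → [n]`), `Ŝ_t` = degree `≤ t`. Here a
  partial injection `α` is a `Finset (Fin m × Fin n)` satisfying `Good` (pairwise distinct
  pigeons and holes); `Ŝ` is modelled inside the free vector space
  `Vec m n F := Finset (Fin m × Fin n) →₀ F` (only good coordinates ever occur);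
  multiplication by the variable `x_p` is the operator `mulVar p` (`x_p · x_ρ = x_{ρ ∪ {p}}` if
  that is a partial injection, `0` otherwise), `Q_i ·` is `Qop i = 1 - ∑_j mulVar (i, j)`, and
  the reduction `F[x̄] → Ŝ` is the linear map `proj` (a monomial goes to `x_A`, `A` its set of
  variables, if `A` is a partial injection, and to `0` otherwise). `proj (X p * f) =
  mulVar p (proj f)` (`proj_X_mul`), so the Boolean, functionality and injectivity axioms are
  killed (`mulVar_mul_self`, `mulVar_mul_eq_zero`) and `proj` does not raise degrees
  (`proj_mem_N`; `Ŝ_k` is `N k`, the vectors supported on good sets of size `≤ k`, with basis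
  `T_k` indexed by `Tfin m n k`).
* p. 334: the *pigeon dance* — `CanDance s L`: the pigeons of the list `L`, in this order, can
  each be moved to a currently free, strictly larger hole; `minDance`: the *minimal* dance (each
  pigeon to the least such hole). `Maps*` elements are pairs `(α, Z)` (`Z = α⁻¹(0)`, a set of
  further pigeons) with `x_{(α,Z)} = x_α · ∏_{i ∈ Z} Q_i` (`bvec α Z`, the product `QZ Z` of the
  commuting idempotents `Qop i`); `B_t` is `Adm m n t` (predicate `AdmP t`: `α` good, `Z`
  disjoint from the pigeons of `α`, `|α| + |Z| ≤ t`, the dance defined on `α`), `C_t` is `AdmC`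
  (`Z ≠ ∅`), `Δ_t` is `AdmD` (`Z = ∅`); `F·B_t` is `SA t` and `F·C_t` is `W t`.
* Claim 1 (p. 335), `x_γ ∈ F·B_{|γ|}` for every partial injection `γ`: `claim1`, by
  well-founded induction on (`|γ|`, the hole sequence of `γ` read from the largest pigeon down —
  the colexicographic key `ckey`, Krajíček's ordering `≺`); the inductive step over all
  attempted dances of `γ` is `claim1_branch`, and the rewriting step is the expansion identity
  `Qop_single_of_notMem` (`Q_i · x_β = x_β - ∑_{h free} x_{β ∪ {(i,h)}}`). Consequence:
  `F·B_k = Ŝ_k` (`SA_eq_N`).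
* Claim 2 (pp. 335–336), the map `D` (the minimal dance of *all* pigeons of `(α, Z)`, those of `Z`
  sitting below every hole) is defined on `B_t` for `t ≤ n/2`: `minDance_isSome_of_canDance`
  ("if a pigeon dance is defined on `α`, the minimal dance is defined on `α` too" — an exchange
  argument, `canDance_swapH`) and `canDance_plist` (the idle pigeons of `Z` can be inserted,
  `canDance_of_filter`, using `2|α| + |Z| ≤ n`).
* Claim 3 (p. 336), `D : B_t → T_t` is injective: each step is (`minDance_injective`,
  `Dmap_injOn`); hence `|B_t| ≤ |T_t|` (`card_AdmF_le`) and, with Claim 1 and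
  `dim Ŝ_t = |T_t|` (`finrank_N`), `B_t` is linearly independent for `2t ≤ n`
  (`linearIndependent_bfam`, through `linearIndependent_iff_card_le_finrank_span`).
* Closure of `F·C_t` under the rules (p. 336): `keyB` (`x_p · F·C_k ⊆ F·C_{k+1}`) and `keyA`
  (`F·C_{k+1} ∩ Ŝ_k ⊆ F·C_k`, from `Ŝ_k = F·C_k ⊕ F·Δ_k`); soundness `inv_of_derivable`: every
  line of a degree-`≤ t` PC-derivation from `¬WPHP^m_n`, `2t ≤ n`, projects into `F·C_t`
  (induction on `PC.DerivableInDegree`; the multiplication rule is decomposed into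
  multiplications by variables, using `MvPolynomial.totalDegree_mul_of_isDomain` to bound the
  degrees of the monomials of the multiplier).
* Conclusion: `1 = x_∅ ∈ Δ_t` is not in `F·C_t` (`single_empty_notMem_W`), hence `1` has no
  degree-`≤ n/2` derivation (`not_refutable`, `Razborov1998_PC_negWPHP_degree_holds`). The
  hypothesis `m > n` of the printed statement is not used (it only makes `¬WPHP^m_n`
  contradictory).

## Sources

* J. Krajíček, *Proof Complexity*, CUP 2019 [KrajicekProofComplexity2019], §16.2, pp. 333–336:
  Thm. 16.2.1, Lemma 16.2.2 and its proof (Claims 1–3).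
* A. A. Razborov, *Lower bounds for the polynomial calculus*, Comput. Complexity 7 (1998)
  [Razborov1998] (the original proof); R. Impagliazzo, P. Pudlák, J. Sgall, *Lower bounds for
  the polynomial calculus and the Gröbner basis algorithm*, Comput. Complexity 8 (1999)
  [ImpagliazzoPudlakSgall1999] (the simplification followed by Krajíček).

## Design notes

* Harmless changes of convention: pigeons `Fin m` and holes `Fin n` are `0`-based; "`α(i) = 0`"
  for `i ∈ Z` is rendered by keeping `Z` as a separate finite set of unplaced pigeons (an
  unplaced pigeon may move to any free hole); dances process pigeons in increasing order and move
  to larger holes, as printed.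
* All operator identities on `Ŝ` are proved pointwise (`Qop_apply`, `Finsupp.lhom_ext`);
  ring-level rewriting in `Module.End F (_ →₀ F)` is deliberately avoided.
* Not here: Lemma 16.2.3 (degree-`≤ n/2` PC-proofs from `¬WPHP` are NS-proofs) and Thm. 16.2.4
  (monomial-size lower bounds from degree lower bounds); neither is needed for Thm. 16.2.1.
-/

namespace Literature.Computability.MetaComplexity
namespace PC
namespace RazborovDance

open Finset

variable {m n : ℕ}

/-! ### Partial injections as finite sets of (pigeon, hole) pairs -/

/-- `Good ρ`: the finite set of pairs `ρ ⊆ [m] × [n]` is (the graph of) a partial injective map.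
[cite: KrajicekProofComplexity2019, §16.2 (pp. 333–336)] -/
def Good (ρ : Finset (Fin m × Fin n)) : Prop :=
  ∀ a ∈ ρ, ∀ b ∈ ρ, a ≠ b → a.1 ≠ b.1 ∧ a.2 ≠ b.2

/-- Decidability of `Good`. [folklore] -/
instance : DecidablePred (@Good m n) := fun ρ => by
  unfold Good; infer_instance

/-- A subset of a partial injection is a partial injection. [folklore] -/
theorem Good.subset {ρ ρ' : Finset (Fin m × Fin n)} (h : Good ρ) (hsub : ρ' ⊆ ρ) : Good ρ' :=
  fun a ha b hb hab => h a (hsub ha) b (hsub hb) hab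

/-- The empty set of pairs is a partial injection. [folklore] -/
theorem good_empty : Good (∅ : Finset (Fin m × Fin n)) := by
  intro a ha; simp at ha

/-- functionality of a good set [folklore] -/
theorem Good.eq_of_fst {ρ : Finset (Fin m × Fin n)} (h : Good ρ) {i : Fin m} {j j' : Fin n}
    (hj : (i, j) ∈ ρ) (hj' : (i, j') ∈ ρ) : j = j' := by
  by_contra hne
  exact (h _ hj _ hj' (by simp [hne])).1 rfl

/-- injectivity of a good set [folklore] -/
theorem Good.eq_of_snd {ρ : Finset (Fin m × Fin n)} (h : Good ρ) {i i' : Fin m} {j : Fin n}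
    (hi : (i, j) ∈ ρ) (hi' : (i', j) ∈ ρ) : i = i' := by
  by_contra hne
  exact (h _ hi _ hi' (by simp [hne])).2 rfl

/-- the set of holes used [folklore] -/
def ran (s : Finset (Fin m × Fin n)) : Finset (Fin n) := s.image Prod.snd

/-- the set of pigeons mapped [folklore] -/
def dom (s : Finset (Fin m × Fin n)) : Finset (Fin m) := s.image Prod.fst

/-- Membership in `ran`. [folklore] -/
theorem mem_ran {s : Finset (Fin m × Fin n)} {h : Fin n} : h ∈ ran s ↔ ∃ i, (i, h) ∈ s := by
  constructor
  · intro hh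
    obtain ⟨⟨i, j⟩, hp, rfl⟩ := Finset.mem_image.mp hh
    exact ⟨i, hp⟩
  · rintro ⟨i, hi⟩
    exact Finset.mem_image.mpr ⟨(i, h), hi, rfl⟩

/-- Membership in `dom`. [folklore] -/
theorem mem_dom {s : Finset (Fin m × Fin n)} {i : Fin m} : i ∈ dom s ↔ ∃ h, (i, h) ∈ s := by
  constructor
  · intro hh
    obtain ⟨⟨i', j⟩, hp, rfl⟩ := Finset.mem_image.mp hh
    exact ⟨j, hp⟩
  · rintro ⟨h, hi⟩
    exact Finset.mem_image.mpr ⟨(i, h), hi, rfl⟩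

/-- Adding a pair with an unplaced pigeon and a free hole keeps a partial injection. [folklore] -/
theorem good_insert {s : Finset (Fin m × Fin n)} (hg : Good s) {i : Fin m} {h : Fin n}
    (hi : i ∉ dom s) (hh : h ∉ ran s) : Good (insert (i, h) s) := by
  rintro ⟨a1, a2⟩ ha ⟨b1, b2⟩ hb hab
  rcases Finset.mem_insert.mp ha with hae | ha
  · simp only [Prod.mk.injEq] at hae
    obtain ⟨rfl, rfl⟩ := hae
    rcases Finset.mem_insert.mp hb with hbe | hb
    · exact absurd hbe.symm hab
    · refine ⟨fun h1 => hi (mem_dom.mpr ⟨b2, ?_⟩), fun h2 => hh (mem_ran.mpr ⟨b1, ?_⟩)⟩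
      · dsimp only at h1; rwa [h1]
      · dsimp only at h2; rwa [h2]
  · rcases Finset.mem_insert.mp hb with hbe | hb
    · simp only [Prod.mk.injEq] at hbe
      obtain ⟨rfl, rfl⟩ := hbe
      refine ⟨fun h1 => hi (mem_dom.mpr ⟨a2, ?_⟩), fun h2 => hh (mem_ran.mpr ⟨a1, ?_⟩)⟩
      · dsimp only at h1; rwa [← h1]
      · dsimp only at h2; rwa [← h2]
    · exact hg _ ha _ hb hab

/-- A partial injection has as many pigeons as pairs. [folklore] -/
theorem Good.card_dom {ρ : Finset (Fin m × Fin n)} (h : Good ρ) : (dom ρ).card = ρ.card := by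
  apply Finset.card_image_of_injOn
  intro a ha b hb hab
  by_contra hne
  exact (h a ha b hb hne).1 hab

/-- A partial injection has as many holes as pairs. [folklore] -/
theorem Good.card_ran {ρ : Finset (Fin m × Fin n)} (h : Good ρ) : (ran ρ).card = ρ.card := by
  apply Finset.card_image_of_injOn
  intro a ha b hb hab
  by_contra hne
  exact (h a ha b hb hne).2 hab

/-! ### Moves and the pigeon dance -/

/-- move pigeon `i` to hole `h` (removing its previous pair, if any)
[cite: KrajicekProofComplexity2019, §16.2 (pp. 333–336)] -/
def move (s : Finset (Fin m × Fin n)) (i : Fin m) (h : Fin n) : Finset (Fin m × Fin n) :=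
  insert (i, h) (s.filter fun p => p.1 ≠ i)

/-- Membership in `move`. [folklore] -/
theorem mem_move {s : Finset (Fin m × Fin n)} {i : Fin m} {h : Fin n} {p : Fin m × Fin n} :
    p ∈ move s i h ↔ p = (i, h) ∨ (p ∈ s ∧ p.1 ≠ i) := by
  simp [move]

/-- Moving an unplaced pigeon just inserts its new pair. [folklore] -/
theorem move_of_notMem_dom {s : Finset (Fin m × Fin n)} {i : Fin m} (h : Fin n) (hi : i ∉ dom s) :
    move s i h = insert (i, h) s := by
  ext p
  rw [mem_move, Finset.mem_insert]
  constructor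
  · rintro (rfl | ⟨hp, _⟩)
    · exact Or.inl rfl
    · exact Or.inr hp
  · rintro (rfl | hp)
    · exact Or.inl rfl
    · refine Or.inr ⟨hp, fun h1 => hi (mem_dom.mpr ⟨p.2, ?_⟩)⟩
      simpa [← h1] using hp

/-- A move occupies at most one new hole. [folklore] -/
theorem ran_move_subset {s : Finset (Fin m × Fin n)} {i : Fin m} {h : Fin n} :
    ran (move s i h) ⊆ insert h (ran s) := by
  intro x hx
  obtain ⟨q, hq⟩ := mem_ran.mp hx
  rcases mem_move.mp hq with hq | ⟨hq, _⟩
  · simp only [Prod.mk.injEq] at hq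
    simp [hq.2]
  · exact Finset.mem_insert_of_mem (mem_ran.mpr ⟨q, hq⟩)

/-- A move occupies at most one new hole (cardinalities). [folklore] -/
theorem card_ran_move_le {s : Finset (Fin m × Fin n)} {i : Fin m} {h : Fin n} :
    (ran (move s i h)).card ≤ (ran s).card + 1 :=
  (Finset.card_le_card ran_move_subset).trans (Finset.card_insert_le _ _)

/-- A move of pigeon `i` to hole `h` is legal in state `s`: `h` is free and above `i`'s current
hole (if `i` is placed). [cite: KrajicekProofComplexity2019, §16.2 (pp. 333–336)] -/
def Legal (s : Finset (Fin m × Fin n)) (i : Fin m) (h : Fin n) : Prop :=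
  h ∉ ran s ∧ ∀ j, (i, j) ∈ s → j < h

/-- Decidability of `Legal`. [folklore] -/
instance (s : Finset (Fin m × Fin n)) (i : Fin m) : DecidablePred (Legal s i) := fun h => by
  unfold Legal; infer_instance

/-- A move to a free hole keeps the state a partial injection. [folklore] -/
theorem good_move {s : Finset (Fin m × Fin n)} (hg : Good s) {i : Fin m} {h : Fin n}
    (hh : h ∉ ran s) : Good (move s i h) := by
  rintro ⟨a1, a2⟩ ha ⟨b1, b2⟩ hb hab
  rcases mem_move.mp ha with hae | ⟨ha, hai⟩
  · simp only [Prod.mk.injEq] at hae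
    obtain ⟨rfl, rfl⟩ := hae
    rcases mem_move.mp hb with hbe | ⟨hb, hbi⟩
    · exact absurd hbe.symm hab
    · refine ⟨fun h1 => hbi ?_, fun h2 => hh (mem_ran.mpr ⟨b1, ?_⟩)⟩
      · dsimp only at h1; exact h1.symm
      · dsimp only at h2; rwa [h2]
  · rcases mem_move.mp hb with hbe | ⟨hb, _⟩
    · simp only [Prod.mk.injEq] at hbe
      obtain ⟨rfl, rfl⟩ := hbe
      refine ⟨hai, fun h2 => hh (mem_ran.mpr ⟨a1, ?_⟩)⟩
      dsimp only at h2; rwa [← h2]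
    · exact hg _ ha _ hb hab

/-- `CanDance s L`: the pigeons of the list `L`, processed in order, can each be moved to a free
strictly larger hole (the non-deterministic pigeon dance can be completed).
[cite: KrajicekProofComplexity2019, §16.2 (pp. 333–336)] -/
def CanDance : Finset (Fin m × Fin n) → List (Fin m) → Prop
  | _, [] => True
  | s, i :: L => ∃ h, Legal s i h ∧ CanDance (move s i h) L

/-- Decidability of `CanDance`, by recursion on the list of pigeons. [folklore] -/
instance decCanDance : ∀ (s : Finset (Fin m × Fin n)) (L : List (Fin m)), Decidable (CanDance s L)
  | _, [] => isTrue trivial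
  | s, i :: L => by
    unfold CanDance
    haveI : ∀ h, Decidable (CanDance (move s i h) L) := fun h => decCanDance _ L
    infer_instance

/-- the set of legal target holes for pigeon `i`
[cite: KrajicekProofComplexity2019, §16.2 (pp. 333–336)] -/
def legalSet (s : Finset (Fin m × Fin n)) (i : Fin m) : Finset (Fin n) :=
  Finset.univ.filter (Legal s i)

/-- Membership in `legalSet`. [folklore] -/
theorem mem_legalSet {s : Finset (Fin m × Fin n)} {i : Fin m} {h : Fin n} :
    h ∈ legalSet s i ↔ Legal s i h := by
  simp [legalSet]

/-- The minimal pigeon dance: each pigeon of `L` in turn moves to the least legal hole; `none` if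
some pigeon is stuck.
[cite: KrajicekProofComplexity2019, §16.2, proof of Lemma 16.2.2 (Claim 2, pp. 335–336)] -/
def minDance : Finset (Fin m × Fin n) → List (Fin m) → Option (Finset (Fin m × Fin n))
  | s, [] => some s
  | s, i :: L =>
    if hne : (legalSet s i).Nonempty then minDance (move s i ((legalSet s i).min' hne)) L else none

/-! ### The exchange lemma: if some dance completes, the minimal dance completes -/

section Exchange

variable (h₀ h : Fin n)

/-- apply the transposition of holes `h₀ ↔ h` to a state [folklore] -/
def swapH (s : Finset (Fin m × Fin n)) : Finset (Fin m × Fin n) :=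
  s.image (Prod.map id (Equiv.swap h₀ h))

/-- Membership in the hole-swapped state. [folklore] -/
theorem mem_swapH {s : Finset (Fin m × Fin n)} {i : Fin m} {j : Fin n} :
    (i, j) ∈ swapH h₀ h s ↔ (i, Equiv.swap h₀ h j) ∈ s := by
  unfold swapH
  rw [Finset.mem_image]
  constructor
  · rintro ⟨⟨a, b⟩, hab, he⟩
    simp only [Prod.map, id_eq, Prod.mk.injEq] at he
    obtain ⟨rfl, rfl⟩ := he
    simpa using hab
  · intro hij
    exact ⟨(i, Equiv.swap h₀ h j), hij, by simp⟩

/-- Swapping two holes commutes with moves. [folklore] -/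
theorem swapH_move (s : Finset (Fin m × Fin n)) (i : Fin m) (x : Fin n) :
    swapH h₀ h (move s i x) = move (swapH h₀ h s) i (Equiv.swap h₀ h x) := by
  ext ⟨a, j⟩
  rw [mem_swapH, mem_move, mem_move, mem_swapH]
  simp only [Prod.mk.injEq]
  constructor
  · rintro (⟨rfl, hj⟩ | h2)
    · left; exact ⟨rfl, by rw [← hj, Equiv.swap_apply_self]⟩
    · right; exact h2
  · rintro (⟨rfl, rfl⟩ | h2)
    · left; exact ⟨rfl, by rw [Equiv.swap_apply_self]⟩
    · right; exact h2

/-- Swapping two free holes does nothing. [folklore] -/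
theorem swapH_eq_self {s : Finset (Fin m × Fin n)} (h0 : h₀ ∉ ran s) (h1 : h ∉ ran s) :
    swapH h₀ h s = s := by
  ext ⟨a, j⟩
  rw [mem_swapH]
  by_cases hj0 : j = h₀
  · subst hj0
    rw [Equiv.swap_apply_left]
    constructor
    · intro hm; exact absurd (mem_ran.mpr ⟨a, hm⟩) h1
    · intro hm; exact absurd (mem_ran.mpr ⟨a, hm⟩) h0
  by_cases hj1 : j = h
  · subst hj1
    rw [Equiv.swap_apply_right]
    constructor
    · intro hm; exact absurd (mem_ran.mpr ⟨a, hm⟩) h0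
    · intro hm; exact absurd (mem_ran.mpr ⟨a, hm⟩) h1
  rw [Equiv.swap_apply_of_ne_of_ne hj0 hj1]

variable {h₀ h}

/-- **Exchange lemma.** Let `h₀ < h`. Suppose hole `h` is occupied by an already-processed pigeon
and hole `h₀` is occupied only by already-processed pigeons (e.g. free). If the remaining pigeons
`L` can complete a dance from `s`, they can also complete one from the state with `h₀` and `h`
interchanged.
[cite: KrajicekProofComplexity2019, §16.2, proof of Lemma 16.2.2 (Claim 2, pp. 335–336)] -/
theorem canDance_swapH (hlt : h₀ < h) :
    ∀ (L : List (Fin m)) (s : Finset (Fin m × Fin n)), L.Nodup →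
      (∃ q, q ∉ L ∧ (q, h) ∈ s) → (∀ q, (q, h₀) ∈ s → q ∉ L) →
      CanDance s L → CanDance (swapH h₀ h s) L
  | [], _, _, _, _, _ => trivial
  | i :: L, s, hnd, ⟨q, hqL, hqs⟩, hq0, ⟨h', ⟨h'ran, h'lt⟩, hcan⟩ => by
    have hiL : i ∉ L := (List.nodup_cons.mp hnd).1
    have hndL : L.Nodup := (List.nodup_cons.mp hnd).2
    have hqi : q ≠ i := fun he => hqL (he ▸ List.mem_cons_self)
    have hih0 : (i, h₀) ∉ s := fun hm => hq0 i hm List.mem_cons_self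
    by_cases hc : h' = h₀
    · rw [hc] at h'ran h'lt hcan
      refine ⟨h, ⟨?_, ?_⟩, ?_⟩
      · intro hm
        obtain ⟨i', hi'⟩ := mem_ran.mp hm
        rw [mem_swapH, Equiv.swap_apply_right] at hi'
        exact h'ran (mem_ran.mpr ⟨i', hi'⟩)
      · intro j hj
        rw [mem_swapH] at hj
        have hlt' := h'lt _ hj
        by_cases hj0 : j = h₀
        · rw [hj0, Equiv.swap_apply_left] at hlt'; exact absurd (hlt.trans hlt') (lt_irrefl _)
        by_cases hj1 : j = h
        · rw [hj1, Equiv.swap_apply_right] at hlt'; exact absurd hlt' (lt_irrefl _)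
        rw [Equiv.swap_apply_of_ne_of_ne hj0 hj1] at hlt'
        exact hlt'.trans hlt
      · have := canDance_swapH hlt L (move s i h₀) hndL
          ⟨q, fun hm => hqL (List.mem_cons_of_mem _ hm), mem_move.mpr (Or.inr ⟨hqs, hqi⟩)⟩
          (by
            intro q' hq'
            rcases mem_move.mp hq' with he | ⟨hm, _⟩
            · simp only [Prod.mk.injEq] at he
              rw [he.1]; exact hiL
            · exact absurd (mem_ran.mpr ⟨q', hm⟩) h'ran)
          hcan
        rwa [swapH_move, Equiv.swap_apply_left] at this
    · have hh'h : h' ≠ h := fun he => h'ran (he ▸ mem_ran.mpr ⟨q, hqs⟩)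
      refine ⟨h', ⟨?_, ?_⟩, ?_⟩
      · intro hm
        obtain ⟨i', hi'⟩ := mem_ran.mp hm
        rw [mem_swapH, Equiv.swap_apply_of_ne_of_ne hc hh'h] at hi'
        exact h'ran (mem_ran.mpr ⟨i', hi'⟩)
      · intro j hj
        rw [mem_swapH] at hj
        by_cases hj0 : j = h₀
        · rw [hj0, Equiv.swap_apply_left] at hj
          exact hj0 ▸ hlt.trans (h'lt _ hj)
        by_cases hj1 : j = h
        · rw [hj1, Equiv.swap_apply_right] at hj; exact absurd hj hih0
        rw [Equiv.swap_apply_of_ne_of_ne hj0 hj1] at hj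
        exact h'lt _ hj
      · have := canDance_swapH hlt L (move s i h') hndL
          ⟨q, fun hm => hqL (List.mem_cons_of_mem _ hm), mem_move.mpr (Or.inr ⟨hqs, hqi⟩)⟩
          (by
            intro q' hq'
            rcases mem_move.mp hq' with he | ⟨hm, _⟩
            · simp only [Prod.mk.injEq] at he
              exact absurd he.2.symm hc
            · exact fun hL => hq0 q' hm (List.mem_cons_of_mem _ hL))
          hcan
        rwa [swapH_move, Equiv.swap_apply_of_ne_of_ne hc hh'h] at this

end Exchange

/-- If some pigeon dance of `L` (distinct pigeons) can be completed from `s`, then the minimal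
dance is defined. (Krajíček 2019, proof of Claim 2: "if a pigeon dance is defined on α, the
minimal dance is defined on α too".)
[cite: KrajicekProofComplexity2019, §16.2, proof of Lemma 16.2.2 (Claim 2, pp. 335–336)] -/
theorem minDance_isSome_of_canDance :
    ∀ (L : List (Fin m)) (s : Finset (Fin m × Fin n)), L.Nodup → CanDance s L →
      (minDance s L).isSome = true
  | [], _, _, _ => rfl
  | i :: L, s, hnd, ⟨h, hleg, hcan⟩ => by
    have hiL : i ∉ L := (List.nodup_cons.mp hnd).1
    have hndL : L.Nodup := (List.nodup_cons.mp hnd).2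
    have hmem : h ∈ legalSet s i := mem_legalSet.mpr hleg
    have hne : (legalSet s i).Nonempty := ⟨h, hmem⟩
    simp only [minDance, hne, dif_pos]
    have h₀leg : Legal s i ((legalSet s i).min' hne) := mem_legalSet.mp (Finset.min'_mem _ hne)
    have h₀le : (legalSet s i).min' hne ≤ h := Finset.min'_le _ _ hmem
    rcases h₀le.eq_or_lt with heq | hlt
    · rw [heq]; exact minDance_isSome_of_canDance L _ hndL hcan
    · apply minDance_isSome_of_canDance L _ hndL
      have key := canDance_swapH hlt L (move s i h) hndL
        ⟨i, hiL, mem_move.mpr (Or.inl rfl)⟩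
        (by
          intro q' hq'
          rcases mem_move.mp hq' with he | ⟨hm, _⟩
          · simp only [Prod.mk.injEq] at he
            exact absurd he.2 hlt.ne
          · exact absurd (mem_ran.mpr ⟨q', hm⟩) h₀leg.1)
        hcan
      rwa [swapH_move, Equiv.swap_apply_right, swapH_eq_self _ _ h₀leg.1 hleg.1] at key

/-! ### Adding idle pigeons to a dance -/

/-- The targets of one completing dance can be avoided: there is a set `T` of at most `|L|` holes
such that placing a new pigeon (not in `L`) at any hole outside `ran s ∪ T` keeps the dance of
`L` completable.
[cite: KrajicekProofComplexity2019, §16.2, proof of Lemma 16.2.2 (Claim 2, pp. 335–336)] -/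
theorem canDance_insert_aux :
    ∀ (L : List (Fin m)) (s : Finset (Fin m × Fin n)), CanDance s L →
      ∃ T : Finset (Fin n), T.card ≤ L.length ∧
        ∀ h₁, h₁ ∉ ran s → h₁ ∉ T → ∀ i, i ∉ L → CanDance (insert (i, h₁) s) L
  | [], _, _ => ⟨∅, by simp, fun _ _ _ _ _ => trivial⟩
  | i' :: L, s, ⟨h', ⟨h'ran, h'lt⟩, hcan⟩ => by
    obtain ⟨T, hTcard, hT⟩ := canDance_insert_aux L (move s i' h') hcan
    refine ⟨insert h' T, ?_, ?_⟩
    · simp only [List.length_cons]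
      exact (Finset.card_insert_le _ _).trans (by omega)
    · intro h₁ hh₁ hh₁T i hi
      have hii' : i ≠ i' := fun he => hi (he ▸ List.mem_cons_self)
      have hh₁h' : h₁ ≠ h' := fun he => hh₁T (he ▸ Finset.mem_insert_self _ _)
      refine ⟨h', ⟨?_, ?_⟩, ?_⟩
      · intro hm
        obtain ⟨q, hq⟩ := mem_ran.mp hm
        rcases Finset.mem_insert.mp hq with he | hq
        · simp only [Prod.mk.injEq] at he; exact hh₁h' he.2.symm
        · exact h'ran (mem_ran.mpr ⟨q, hq⟩)
      · intro j hj
        rcases Finset.mem_insert.mp hj with he | hj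
        · simp only [Prod.mk.injEq] at he; exact absurd he.1.symm hii'
        · exact h'lt j hj
      · have hmv : move (insert (i, h₁) s) i' h' = insert (i, h₁) (move s i' h') := by
          ext p
          simp only [mem_move, Finset.mem_insert]
          constructor
          · rintro (rfl | ⟨rfl | hp, hpi⟩)
            · exact Or.inr (Or.inl rfl)
            · exact Or.inl rfl
            · exact Or.inr (Or.inr ⟨hp, hpi⟩)
          · rintro (rfl | rfl | ⟨hp, hpi⟩)
            · exact Or.inr ⟨Or.inl rfl, hii'⟩
            · exact Or.inl rfl
            · exact Or.inr ⟨Or.inr hp, hpi⟩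
        rw [hmv]
        refine hT h₁ ?_ (fun hm => hh₁T (Finset.mem_insert_of_mem hm)) i
          (fun hm => hi (List.mem_cons_of_mem _ hm))
        intro hm
        rcases Finset.mem_insert.mp (ran_move_subset hm) with he | hm
        · exact hh₁h' he
        · exact hh₁ hm

/-- An idle pigeon can be added at some free hole without spoiling a completable dance, provided
there is room.
[cite: KrajicekProofComplexity2019, §16.2, proof of Lemma 16.2.2 (Claim 2, pp. 335–336)] -/
theorem canDance_insert {L : List (Fin m)} {s : Finset (Fin m × Fin n)} (hcan : CanDance s L)
    {i : Fin m} (hi : i ∉ L) (hroom : (ran s).card + L.length < n) :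
    ∃ h₁, h₁ ∉ ran s ∧ CanDance (insert (i, h₁) s) L := by
  obtain ⟨T, hTcard, hT⟩ := canDance_insert_aux L s hcan
  have hlt : (ran s ∪ T).card < (Finset.univ : Finset (Fin n)).card := by
    rw [Finset.card_univ, Fintype.card_fin]
    exact (Finset.card_union_le _ _).trans_lt (by omega)
  obtain ⟨h₁, -, hh₁⟩ := Finset.exists_mem_notMem_of_card_lt_card hlt
  rw [Finset.mem_union, not_or] at hh₁
  exact ⟨h₁, hh₁.1, hT h₁ hh₁.1 hh₁.2 i hi⟩

/-- **Superlist lemma.** If the sub-list of `L` selected by `P` can dance from `s`, the other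
pigeons of `L` are not placed in `s`, `L` has no duplicates and there is room
(`|ran s| + |L| ≤ n`), then all of `L` can dance from `s` (idle pigeons are inserted at suitable
free holes and then moved anywhere above).
[cite: KrajicekProofComplexity2019, §16.2, proof of Lemma 16.2.2 (Claim 2, pp. 335–336)] -/
theorem canDance_of_filter (P : Fin m → Prop) [DecidablePred P] :
    ∀ (L : List (Fin m)) (s : Finset (Fin m × Fin n)), L.Nodup →
      (∀ i ∈ L, ¬ P i → i ∉ dom s) → (ran s).card + L.length ≤ n →
      CanDance s (L.filter fun i => P i) → CanDance s L
  | [], _, _, _, _, _ => trivial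
  | i :: L, s, hnd, hdom, hroom, hcan => by
    have hiL : i ∉ L := (List.nodup_cons.mp hnd).1
    have hndL : L.Nodup := (List.nodup_cons.mp hnd).2
    by_cases hP : P i
    · rw [List.filter_cons_of_pos (by simpa using hP)] at hcan
      obtain ⟨h, hleg, hcan⟩ := hcan
      refine ⟨h, hleg, canDance_of_filter P L _ hndL ?_ ?_ hcan⟩
      · intro i' hi' hP' hm
        obtain ⟨x, hx⟩ := mem_dom.mp hm
        rcases mem_move.mp hx with he | ⟨hx, _⟩
        · simp only [Prod.mk.injEq] at he
          exact hiL (he.1 ▸ hi')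
        · exact hdom i' (List.mem_cons_of_mem _ hi') hP' (mem_dom.mpr ⟨x, hx⟩)
      · simp only [List.length_cons] at hroom
        exact (Nat.add_le_add_right card_ran_move_le _).trans (by omega)
    · rw [List.filter_cons_of_neg (by simpa using hP)] at hcan
      have hidom : i ∉ dom s := hdom i List.mem_cons_self hP
      -- first make the filtered dance avoid a fresh hole for `i`
      have hiF : i ∉ L.filter fun i => P i := fun hm => hiL (List.mem_of_mem_filter hm)
      have hroom' : (ran s).card + (L.filter fun i => P i).length < n := by
        have := List.length_filter_le (fun i => decide (P i)) L
        simp only [List.length_cons] at hroom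
        omega
      obtain ⟨h₁, hh₁, hcan₁⟩ := canDance_insert hcan hiF hroom'
      refine ⟨h₁, ⟨hh₁, fun j hj => absurd (mem_dom.mpr ⟨j, hj⟩) hidom⟩, ?_⟩
      rw [move_of_notMem_dom h₁ hidom]
      refine canDance_of_filter P L _ hndL ?_ ?_ hcan₁
      · intro i' hi' hP' hm
        obtain ⟨x, hx⟩ := mem_dom.mp hm
        rcases Finset.mem_insert.mp hx with he | hx
        · simp only [Prod.mk.injEq] at he
          exact hiL (he.1 ▸ hi')
        · exact hdom i' (List.mem_cons_of_mem _ hi') hP' (mem_dom.mpr ⟨x, hx⟩)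
      · have : ran (insert (i, h₁) s) ⊆ insert h₁ (ran s) := by
          intro x hx
          obtain ⟨q, hq⟩ := mem_ran.mp hx
          rcases Finset.mem_insert.mp hq with he | hq
          · simp only [Prod.mk.injEq] at he; simp [he.2]
          · exact Finset.mem_insert_of_mem (mem_ran.mpr ⟨q, hq⟩)
        have := (Finset.card_le_card this).trans (Finset.card_insert_le _ _)
        simp only [List.length_cons] at hroom
        omega

/-! ### Properties of the minimal dance: goodness, domain, injectivity (Claim 3) -/

/-- The minimal dance ends in a partial injection. [cite: KrajicekProofComplexity2019, §16.2, proof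
of Lemma 16.2.2 (Claim 2, pp. 335–336)] -/
theorem minDance_good :
    ∀ (L : List (Fin m)) (s r : Finset (Fin m × Fin n)), Good s → minDance s L = some r → Good r
  | [], s, r, hg, hr => by
    simp only [minDance, Option.some.injEq] at hr
    exact hr ▸ hg
  | i :: L, s, r, hg, hr => by
    simp only [minDance] at hr
    split_ifs at hr with hne
    exact minDance_good L _ r (good_move hg (mem_legalSet.mp (Finset.min'_mem _ hne)).1) hr

/-- pairs of the result: old pairs of unprocessed pigeons are kept [folklore] -/
theorem minDance_mem_of_notMem :
    ∀ (L : List (Fin m)) (s r : Finset (Fin m × Fin n)), minDance s L = some r →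
      ∀ p ∈ s, p.1 ∉ L → p ∈ r
  | [], s, r, hr, p, hp, _ => by
    simp only [minDance, Option.some.injEq] at hr
    exact hr ▸ hp
  | i :: L, s, r, hr, p, hp, hpL => by
    simp only [minDance] at hr
    split_ifs at hr with hne
    refine minDance_mem_of_notMem L _ r hr p (mem_move.mpr (Or.inr ⟨hp, ?_⟩))
      (fun hm => hpL (List.mem_cons_of_mem _ hm))
    exact fun he => hpL (he ▸ List.mem_cons_self)

/-- pairs of the result come from `s` or belong to processed pigeons [folklore] -/
theorem minDance_mem_cases :
    ∀ (L : List (Fin m)) (s r : Finset (Fin m × Fin n)), minDance s L = some r →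
      ∀ p ∈ r, p ∈ s ∨ p.1 ∈ L
  | [], s, r, hr, p, hp => by
    simp only [minDance, Option.some.injEq] at hr
    exact Or.inl (hr ▸ hp)
  | i :: L, s, r, hr, p, hp => by
    simp only [minDance] at hr
    split_ifs at hr with hne
    rcases minDance_mem_cases L _ r hr p hp with hm | hm
    · rcases mem_move.mp hm with rfl | ⟨hm, _⟩
      · exact Or.inr List.mem_cons_self
      · exact Or.inl hm
    · exact Or.inr (List.mem_cons_of_mem _ hm)

/-- every processed pigeon is placed in the result [folklore] -/
theorem minDance_mem_dom :
    ∀ (L : List (Fin m)) (s r : Finset (Fin m × Fin n)), L.Nodup → minDance s L = some r →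
      ∀ i ∈ L, i ∈ dom r
  | [], _, _, _, _, i, hi => by simp at hi
  | i :: L, s, r, hnd, hr, i', hi' => by
    have hiL : i ∉ L := (List.nodup_cons.mp hnd).1
    have hndL : L.Nodup := (List.nodup_cons.mp hnd).2
    simp only [minDance] at hr
    split_ifs at hr with hne
    rcases List.mem_cons.mp hi' with rfl | hi'
    · exact mem_dom.mpr ⟨_, minDance_mem_of_notMem L _ r hr _ (mem_move.mpr (Or.inl rfl)) hiL⟩
    · exact minDance_mem_dom L _ r hndL hr i' hi'

/-- The pigeons placed at the end of the minimal dance are the initial ones together with the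
processed ones. [cite: KrajicekProofComplexity2019, §16.2, proof of Lemma 16.2.2 (Claim 2, pp.
335–336)] -/
theorem minDance_dom {L : List (Fin m)} {s r : Finset (Fin m × Fin n)} (hnd : L.Nodup)
    (hr : minDance s L = some r) : dom r = dom s ∪ L.toFinset := by
  ext i
  rw [Finset.mem_union, List.mem_toFinset, mem_dom, mem_dom]
  constructor
  · rintro ⟨x, hx⟩
    rcases minDance_mem_cases L s r hr _ hx with hm | hm
    · exact Or.inl ⟨x, hm⟩
    · exact Or.inr hm
  · rintro (⟨x, hx⟩ | hi)
    · by_cases hiL : i ∈ L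
      · exact mem_dom.mp (minDance_mem_dom L s r hnd hr i hiL)
      · exact ⟨x, minDance_mem_of_notMem L s r hr _ hx hiL⟩
    · exact mem_dom.mp (minDance_mem_dom L s r hnd hr i hi)

/-- one direction of the injectivity of a single minimal step
[cite: KrajicekProofComplexity2019, §16.2, proof of Lemma 16.2.2 (Claim 3, p. 336)] -/
theorem step_inj_aux {s s' : Finset (Fin m × Fin n)} (hg : Good s) (hg' : Good s') {i : Fin m}
    {x : Fin n} (hagree : ∀ p : Fin m × Fin n, p.1 ≠ i → (p ∈ s ↔ p ∈ s'))
    (hx : Legal s i x) (hx' : Legal s' i x) (hmin : ∀ y, Legal s i y → x ≤ y)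
    (hmin' : ∀ y, Legal s' i y → x ≤ y) : ∀ j, (i, j) ∈ s → (i, j) ∈ s' := by
  intro j hj
  by_contra hj'
  by_cases hex : ∃ j', (i, j') ∈ s'
  · obtain ⟨j', hj's⟩ := hex
    have hne : j' ≠ j := fun he => hj' (he ▸ hj's)
    rcases lt_or_gt_of_ne hne with hlt | hlt
    · -- j' < j : then `j` is legal for `s'`, so x ≤ j, but j < x by legality in `s`
      have hleg : Legal s' i j := by
        refine ⟨fun hm => ?_, fun j'' hj'' => (hg'.eq_of_fst hj'' hj's) ▸ hlt⟩
        obtain ⟨q, hq⟩ := mem_ran.mp hm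
        have hqi : q ≠ i := fun he => hj' (he ▸ hq)
        have hqs : (q, j) ∈ s := (hagree (q, j) hqi).mpr hq
        exact hqi (hg.eq_of_snd hqs hj)
      exact absurd (hx.2 j hj) (not_lt.mpr (hmin' j hleg))
    · -- j < j'
      have hleg : Legal s i j' := by
        refine ⟨fun hm => ?_, fun j'' hj'' => (hg.eq_of_fst hj'' hj) ▸ hlt⟩
        obtain ⟨q, hq⟩ := mem_ran.mp hm
        have hqi : q ≠ i := fun he => hne (hg.eq_of_fst (he ▸ hq) hj)
        have hqs : (q, j') ∈ s' := (hagree (q, j') hqi).mp hq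
        exact hqi (hg'.eq_of_snd hqs hj's)
      exact absurd (hx'.2 j' hj's) (not_lt.mpr (hmin j' hleg))
  · push Not at hex
    have hleg : Legal s' i j := by
      refine ⟨fun hm => ?_, fun j'' hj'' => absurd hj'' (hex j'')⟩
      obtain ⟨q, hq⟩ := mem_ran.mp hm
      have hqi : q ≠ i := fun he => hex j (he ▸ hq)
      have hqs : (q, j) ∈ s := (hagree (q, j) hqi).mpr hq
      exact hqi (hg.eq_of_snd hqs hj)
    exact absurd (hx.2 j hj) (not_lt.mpr (hmin' j hleg))

/-- **Claim 3**: for a fixed processing list, the minimal dance is injective on good states.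
[cite: KrajicekProofComplexity2019, §16.2, proof of Lemma 16.2.2 (Claim 3, p. 336)] -/
theorem minDance_injective :
    ∀ (L : List (Fin m)) (s s' r : Finset (Fin m × Fin n)), Good s → Good s' →
      minDance s L = some r → minDance s' L = some r → s = s'
  | [], s, s', r, _, _, hr, hr' => by
    simp only [minDance, Option.some.injEq] at hr hr'
    rw [hr, hr']
  | i :: L, s, s', r, hg, hg', hr, hr' => by
    simp only [minDance] at hr hr'
    split_ifs at hr hr' with hne hne'
    set x := (legalSet s i).min' hne with hxdef
    set x' := (legalSet s' i).min' hne' with hx'def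
    have hxl : Legal s i x := mem_legalSet.mp (Finset.min'_mem _ hne)
    have hxl' : Legal s' i x' := mem_legalSet.mp (Finset.min'_mem _ hne')
    have hmv := minDance_injective L _ _ r (good_move hg hxl.1) (good_move hg' hxl'.1) hr hr'
    -- compare the two moved states
    have hxx' : x = x' := by
      have : (i, x) ∈ move s' i x' := hmv ▸ mem_move.mpr (Or.inl rfl)
      rcases mem_move.mp this with he | ⟨_, hne⟩
      · simpa using he
      · exact absurd rfl hne
    have hagree : ∀ p : Fin m × Fin n, p.1 ≠ i → (p ∈ s ↔ p ∈ s') := by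
      intro p hpi
      have h1 : p ∈ s ↔ p ∈ move s i x := by
        rw [mem_move]; constructor
        · exact fun hp => Or.inr ⟨hp, hpi⟩
        · rintro (rfl | ⟨hp, _⟩)
          · exact absurd rfl hpi
          · exact hp
      have h2 : p ∈ s' ↔ p ∈ move s' i x' := by
        rw [mem_move]; constructor
        · exact fun hp => Or.inr ⟨hp, hpi⟩
        · rintro (rfl | ⟨hp, _⟩)
          · exact absurd rfl hpi
          · exact hp
      rw [h1, h2, hmv]
    have hmin : ∀ y, Legal s i y → x ≤ y := fun y hy => Finset.min'_le _ _ (mem_legalSet.mpr hy)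
    have hmin' : ∀ y, Legal s' i y → x' ≤ y := fun y hy => Finset.min'_le _ _ (mem_legalSet.mpr hy)
    rw [← hxx'] at hxl' hmin'
    have A := step_inj_aux hg hg' hagree hxl hxl' hmin hmin'
    have B := step_inj_aux hg' hg (fun p hp => (hagree p hp).symm) hxl' hxl hmin' hmin
    ext ⟨a, j⟩
    by_cases hai : a = i
    · subst hai; exact ⟨A j, B j⟩
    · exact hagree (a, j) hai

/-! ### The vector space `Ŝ` and the operators `x_{ij}·` and `Q_i·` -/

section Alg

variable {F : Type*} [Field F]

/-- The free `F`-vector space on finite sets of pairs; the good sets span the quotient ring `Ŝ`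
of Krajíček 2019, §16.2 (basis `T = {x_α}`).
[cite: KrajicekProofComplexity2019, §16.2 (pp. 333–336)] -/
abbrev Vec (m n : ℕ) (F : Type*) [Field F] := Finset (Fin m × Fin n) →₀ F

/-- multiplication by the variable `x_p` on `Ŝ`: `x_p · x_ρ = x_{ρ ∪ {p}}` if that is a partial
injection, and `0` otherwise [cite: KrajicekProofComplexity2019, §16.2 (pp. 333–336)] -/
noncomputable def mulVar (p : Fin m × Fin n) : Module.End F (Vec m n F) :=
  Finsupp.lsum F (fun ρ => if Good (insert p ρ) then Finsupp.lsingle (insert p ρ) else 0)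

/-- `x_p · x_ρ` on a basis vector: `x_{ρ ∪ {p}}` if that is a partial injection (computing in `Ŝ`),
else `0`. [cite: KrajicekProofComplexity2019, §16.2 (pp. 333–336)] -/
theorem mulVar_single (p : Fin m × Fin n) (ρ : Finset (Fin m × Fin n)) (a : F) :
    mulVar p (Finsupp.single ρ a) =
      if Good (insert p ρ) then Finsupp.single (insert p ρ) a else 0 := by
  unfold mulVar
  rw [Finsupp.lsum_single]
  split_ifs <;> simp

/-- Two variable multiplications on a basis vector. [folklore] -/
theorem mulVar_mulVar_single (p q : Fin m × Fin n) (ρ : Finset (Fin m × Fin n)) (a : F) :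
    mulVar p (mulVar q (Finsupp.single ρ a)) =
      if Good (insert p (insert q ρ)) then Finsupp.single (insert p (insert q ρ)) a else 0 := by
  rw [mulVar_single]
  split_ifs with h1 h2 h2
  · rw [mulVar_single, if_pos h2]
  · rw [mulVar_single, if_neg h2]
  · exact absurd (h2.subset (Finset.subset_insert _ _)) h1
  · exact map_zero _

/-- The operators `x_p ·` commute. [folklore] -/
theorem mulVar_comm (p q : Fin m × Fin n) :
    mulVar (F := F) p * mulVar q = mulVar q * mulVar p := by
  apply Finsupp.lhom_ext
  intro ρ a
  simp only [Module.End.mul_apply, mulVar_mulVar_single, Finset.insert_comm p q]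

/-- `x_p · x_p · v = x_p · v` on `Ŝ` (the Boolean axiom `x² = x`). [cite:
KrajicekProofComplexity2019, §16.2 (pp. 333–336)] -/
theorem mulVar_mul_self (p : Fin m × Fin n) :
    mulVar (F := F) p * mulVar p = mulVar p := by
  apply Finsupp.lhom_ext
  intro ρ a
  rw [Module.End.mul_apply, mulVar_mulVar_single, Finset.insert_idem, mulVar_single]

/-- `x_{ij} x_{ij'} · v = 0 = x_{ij} x_{i'j} · v` on `Ŝ` (the axioms `Q_{i;j,j'}`, `Q_{i,i';j}`).
[cite: KrajicekProofComplexity2019, §16.2 (pp. 333–336)] -/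
theorem mulVar_mul_eq_zero {p q : Fin m × Fin n} (hne : p ≠ q) (h : p.1 = q.1 ∨ p.2 = q.2) :
    mulVar (F := F) p * mulVar q = 0 := by
  apply Finsupp.lhom_ext
  intro ρ a
  simp only [Module.End.mul_apply, mulVar_mulVar_single, LinearMap.zero_apply]
  rw [if_neg]
  intro hg
  have := hg p (Finset.mem_insert_self _ _) q
    (Finset.mem_insert_of_mem (Finset.mem_insert_self _ _)) hne
  tauto

/-- the operator `S_i = ∑_j x_{ij}·` on `Ŝ`
[cite: KrajicekProofComplexity2019, §16.2 (pp. 333–336)] -/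
noncomputable def Sop (i : Fin m) : Module.End F (Vec m n F) :=
  ∑ j : Fin n, mulVar (i, j)

/-- Unfolding of `Sop`. [folklore] -/
theorem Sop_apply (i : Fin m) (v : Vec m n F) : Sop i v = ∑ j : Fin n, mulVar (i, j) v := by
  simp [Sop, LinearMap.coe_sum]

/-- the operator `Q_i ·` on `Ŝ`, `Q_i = 1 - ∑_j x_{ij}`
[cite: KrajicekProofComplexity2019, §16.2 (pp. 333–336)] -/
noncomputable def Qop (i : Fin m) : Module.End F (Vec m n F) :=
  1 - Sop i

/-- Unfolding of `Qop`: `Q_i · v = v - ∑_j x_{ij} · v`. [cite: KrajicekProofComplexity2019, §16.2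
(pp. 333–336)] -/
theorem Qop_apply (i : Fin m) (v : Vec m n F) : Qop i v = v - ∑ j : Fin n, mulVar (i, j) v := by
  rw [Qop, LinearMap.sub_apply, Module.End.one_apply, Sop_apply]

/-- The operators `x_p ·` commute (pointwise form). [folklore] -/
theorem mulVar_comm_apply (p q : Fin m × Fin n) (v : Vec m n F) :
    mulVar p (mulVar q v) = mulVar q (mulVar p v) := by
  have := congrArg (fun f => f v) (mulVar_comm (F := F) p q)
  simpa only [Module.End.mul_apply] using this

/-- The operators `S_i` commute (pointwise form). [folklore] -/
theorem Sop_comm_apply (i i' : Fin m) (v : Vec m n F) : Sop i (Sop i' v) = Sop i' (Sop i v) := by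
  simp only [Sop_apply, map_sum]
  rw [Finset.sum_comm]
  refine Finset.sum_congr rfl fun j _ => Finset.sum_congr rfl fun j' _ => ?_
  exact mulVar_comm_apply _ _ _

/-- `x_p ·` commutes with `S_i` (pointwise form). [folklore] -/
theorem mulVar_Sop_apply (p : Fin m × Fin n) (i : Fin m) (v : Vec m n F) :
    mulVar p (Sop i v) = Sop i (mulVar p v) := by
  simp only [Sop_apply, map_sum]
  exact Finset.sum_congr rfl fun j _ => mulVar_comm_apply _ _ _

/-- `x_p ·` commutes with `Q_i ·` (pointwise form). [folklore] -/
theorem mulVar_Qop_apply (p : Fin m × Fin n) (i : Fin m) (v : Vec m n F) :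
    mulVar p (Qop i v) = Qop i (mulVar p v) := by
  rw [Qop, LinearMap.sub_apply, LinearMap.sub_apply, map_sub, Module.End.one_apply,
    Module.End.one_apply, mulVar_Sop_apply]

/-- The operators `Q_i ·` commute (pointwise form). [folklore] -/
theorem Qop_Qop_apply (i i' : Fin m) (v : Vec m n F) : Qop i (Qop i' v) = Qop i' (Qop i v) := by
  simp only [Qop, LinearMap.sub_apply, Module.End.one_apply, map_sub]
  rw [Sop_comm_apply i i' v]
  abel

/-- `Q_i ·` commutes with `x_p ·`. [folklore] -/
theorem commute_Qop_mulVar (i : Fin m) (p : Fin m × Fin n) :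
    Commute (Qop (F := F) (n := n) i) (mulVar p) := by
  change Qop i * mulVar p = mulVar p * Qop i
  exact LinearMap.ext fun v => (mulVar_Qop_apply p i v).symm

/-- The operators `Q_i ·` commute. [folklore] -/
theorem commute_Qop (i i' : Fin m) : Commute (Qop (F := F) (n := n) i) (Qop i') := by
  change Qop i * Qop i' = Qop i' * Qop i
  exact LinearMap.ext fun v => Qop_Qop_apply i i' v

/-- `Q_i · x_β = 0` in `Ŝ` when pigeon `i` is placed in `β`
[cite: KrajicekProofComplexity2019, §16.2 (pp. 333–336)] -/
theorem Qop_single_of_mem {β : Finset (Fin m × Fin n)} (hg : Good β) {i : Fin m} {j₀ : Fin n}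
    (h : (i, j₀) ∈ β) (a : F) : Qop i (Finsupp.single β a) = 0 := by
  simp only [Qop_apply, mulVar_single]
  rw [Finset.sum_eq_single j₀]
  · rw [if_pos, Finset.insert_eq_of_mem h, sub_self]
    rwa [Finset.insert_eq_of_mem h]
  · intro j _ hj
    rw [if_neg]
    intro hg'
    exact (hg' (i, j) (Finset.mem_insert_self _ _) (i, j₀) (Finset.mem_insert_of_mem h)
      (by simpa using hj)).1 rfl
  · intro h; exact absurd (Finset.mem_univ _) h

/-- For an unplaced pigeon `i`, `β ∪ {(i, j)}` is a partial injection iff the hole `j` is free.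
[folklore] -/
theorem good_insert_iff {β : Finset (Fin m × Fin n)} (hg : Good β) {i : Fin m} (hi : i ∉ dom β)
    (j : Fin n) : Good (insert (i, j) β) ↔ j ∉ ran β := by
  constructor
  · intro hg' hj
    obtain ⟨q, hq⟩ := mem_ran.mp hj
    have hqi : q ≠ i := fun he => hi (mem_dom.mpr ⟨j, he ▸ hq⟩)
    exact (hg' (i, j) (Finset.mem_insert_self _ _) (q, j) (Finset.mem_insert_of_mem hq)
      (by simp [hqi.symm])).2 rfl
  · exact good_insert hg hi

/-- the free holes of `β` [folklore] -/
def freeH (β : Finset (Fin m × Fin n)) : Finset (Fin n) := Finset.univ.filter fun h => h ∉ ran β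

/-- Membership in `freeH`. [folklore] -/
theorem mem_freeH {β : Finset (Fin m × Fin n)} {h : Fin n} : h ∈ freeH β ↔ h ∉ ran β := by
  simp [freeH]

/-- **Expansion identity**: `Q_i · x_β = x_β - ∑_{h free} x_{β ∪ {(i,h)}}` when pigeon `i` is not
placed in `β` (Krajíček 2019, proof of Claim 1: "use the polynomial axiom `Q_{i_1}` and
rewrite…"). [cite: KrajicekProofComplexity2019, §16.2, proof of Lemma 16.2.2 (Claim 1, p. 335)] -/
theorem Qop_single_of_notMem {β : Finset (Fin m × Fin n)} (hg : Good β) {i : Fin m}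
    (hi : i ∉ dom β) (a : F) :
    Qop i (Finsupp.single β a) =
      Finsupp.single β a - ∑ h ∈ freeH β, Finsupp.single (insert (i, h) β) a := by
  simp only [Qop_apply, mulVar_single]
  congr 1
  rw [freeH, Finset.sum_filter]
  refine Finset.sum_congr rfl fun j _ => ?_
  simp only [good_insert_iff hg hi]

/-- `Q_i` fixes the (irrelevant) basis vectors indexed by non-injective sets. [folklore] -/
theorem Qop_single_of_not_good {β : Finset (Fin m × Fin n)} (hg : ¬ Good β) (i : Fin m) (a : F) :
    Qop i (Finsupp.single β a) = Finsupp.single β a := by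
  simp only [Qop_apply, mulVar_single]
  rw [Finset.sum_eq_zero, sub_zero]
  intro j _
  rw [if_neg]
  exact fun hg' => hg (hg'.subset (Finset.subset_insert _ _))

/-- `Q_i` is idempotent on `Ŝ` [cite: KrajicekProofComplexity2019, §16.2 (pp. 333–336)] -/
theorem Qop_Qop_self_apply (i : Fin m) (v : Vec m n F) : Qop i (Qop i v) = Qop i v := by
  suffices h : Qop (F := F) (n := n) i * Qop i = Qop i by
    have := congrArg (fun f => f v) h
    simpa only [Module.End.mul_apply] using this
  apply Finsupp.lhom_ext
  intro β a
  rw [Module.End.mul_apply]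
  by_cases hg : Good β
  · by_cases hi : i ∈ dom β
    · obtain ⟨j₀, hj₀⟩ := mem_dom.mp hi
      rw [Qop_single_of_mem hg hj₀, map_zero]
    · have h0 : ∑ h ∈ freeH β, Qop i (Finsupp.single (insert (i, h) β) a) = 0 := by
        refine Finset.sum_eq_zero fun h hh => ?_
        rw [mem_freeH] at hh
        exact Qop_single_of_mem (good_insert hg hi hh) (Finset.mem_insert_self _ _) a
      rw [Qop_single_of_notMem hg hi, map_sub, map_sum, Qop_single_of_notMem hg hi, h0, sub_zero]
  · rw [Qop_single_of_not_good hg, Qop_single_of_not_good hg]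

/-- `Q_i ·` is idempotent on `Ŝ` (`Q_i² = Q_i` in `Ŝ`). [cite: KrajicekProofComplexity2019, §16.2
(pp. 333–336)] -/
theorem Qop_mul_self (i : Fin m) : Qop (F := F) (n := n) i * Qop i = Qop i :=
  LinearMap.ext fun v => Qop_Qop_self_apply i v

/-! ### Products `∏_{i ∈ Z} Q_i` and the vectors `x_α · ∏_{i∈Z} Q_i` -/

/-- `QZ Z = ∏_{i ∈ Z} Q_i` (the `Q_i` commute)
[cite: KrajicekProofComplexity2019, §16.2 (pp. 333–336)] -/
noncomputable def QZ (Z : Finset (Fin m)) : Module.End F (Vec m n F) :=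
  Z.noncommProd (fun i => Qop i) fun a _ b _ _ => commute_Qop a b

/-- The empty product of the `Q_i` is the identity. [folklore] -/
theorem QZ_empty : QZ (F := F) (n := n) (∅ : Finset (Fin m)) = 1 :=
  Finset.noncommProd_empty _ _

/-- `∏_{i ∈ Z ∪ {i₀}} Q_i = Q_{i₀} ∏_{i ∈ Z} Q_i` for `i₀ ∉ Z`. [folklore] -/
theorem QZ_insert {Z : Finset (Fin m)} {i : Fin m} (hi : i ∉ Z) :
    QZ (F := F) (n := n) (insert i Z) = Qop i * QZ Z :=
  Finset.noncommProd_insert_of_notMem _ _ _ _ hi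

/-- `Q_{i₀} ∏_{i ∈ Z} Q_i = ∏_{i ∈ Z} Q_i` for `i₀ ∈ Z` (idempotency). [cite:
KrajicekProofComplexity2019, §16.2 (pp. 333–336)] -/
theorem Qop_mul_QZ_of_mem {Z : Finset (Fin m)} {i : Fin m} (hi : i ∈ Z) :
    Qop i * QZ (F := F) (n := n) Z = QZ Z := by
  conv_lhs => rw [← Finset.insert_erase hi]
  conv_rhs => rw [← Finset.insert_erase hi]
  rw [QZ_insert (Finset.notMem_erase _ _), ← mul_assoc, Qop_mul_self]

/-- `Q_{i₀}` commutes with `∏_{i ∈ Z} Q_i`. [folklore] -/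
theorem commute_Qop_QZ (i : Fin m) (Z : Finset (Fin m)) :
    Commute (Qop i) (QZ (F := F) (n := n) Z) :=
  Finset.noncommProd_commute _ _ _ _ fun i' _ => commute_Qop i i'

/-- `x_p ·` commutes with `∏_{i ∈ Z} Q_i`. [folklore] -/
theorem commute_mulVar_QZ (p : Fin m × Fin n) (Z : Finset (Fin m)) :
    Commute (mulVar p) (QZ (F := F) (n := n) Z) :=
  Finset.noncommProd_commute _ _ _ _ fun i' _ => (commute_Qop_mulVar i' p).symm

/-- the element `x_α · ∏_{i ∈ Z} Q_i` of `Ŝ` (Krajíček's `x_α` for `α ∈ Maps*` with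
`α⁻¹(0) = Z`) [cite: KrajicekProofComplexity2019, §16.2 (pp. 333–336)] -/
noncomputable def bvec (α : Finset (Fin m × Fin n)) (Z : Finset (Fin m)) : Vec m n F :=
  QZ Z (Finsupp.single α 1)

/-- `x_α ∏_{i ∈ ∅} Q_i = x_α`. [folklore] -/
theorem bvec_empty (α : Finset (Fin m × Fin n)) :
    bvec (F := F) α (∅ : Finset (Fin m)) = Finsupp.single α 1 := by
  simp [bvec, QZ_empty]

/-- `x_α ∏_{i ∈ Z ∪ {i₀}} Q_i = Q_{i₀} (x_α ∏_{i ∈ Z} Q_i)` for `i₀ ∉ Z`. [folklore] -/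
theorem bvec_insert {α : Finset (Fin m × Fin n)} {Z : Finset (Fin m)} {i : Fin m} (hi : i ∉ Z) :
    bvec (F := F) α (insert i Z) = Qop i (bvec α Z) := by
  simp [bvec, QZ_insert hi]

/-- `Q_{i₀} (x_α ∏_{i ∈ Z} Q_i) = x_α ∏_{i ∈ Z} Q_i` when `i₀ ∈ Z` (p. 336: multiplying by `Q_{i'}`
gives an element of `C_t` again). [cite: KrajicekProofComplexity2019, §16.2 (pp. 333–336)] -/
theorem Qop_bvec_of_mem_Z {α : Finset (Fin m × Fin n)} {Z : Finset (Fin m)} {i : Fin m}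
    (hi : i ∈ Z) : Qop i (bvec (F := F) α Z) = bvec α Z := by
  simp only [bvec]
  rw [← Module.End.mul_apply, Qop_mul_QZ_of_mem hi]

/-- `Q_{i₀} (x_α ∏_{i ∈ Z} Q_i) = 0` when pigeon `i₀` is placed in `α` (p. 336: "… or `0`"). [cite:
KrajicekProofComplexity2019, §16.2 (pp. 333–336)] -/
theorem Qop_bvec_of_mem_dom {α : Finset (Fin m × Fin n)} (hg : Good α) {Z : Finset (Fin m)}
    {i : Fin m} (hi : i ∈ dom α) : Qop i (bvec (F := F) α Z) = 0 := by
  obtain ⟨j₀, hj₀⟩ := mem_dom.mp hi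
  simp only [bvec]
  rw [← Module.End.mul_apply, (commute_Qop_QZ i Z).eq, Module.End.mul_apply,
    Qop_single_of_mem hg hj₀, map_zero]

/-! ### The degree filtration `Ŝ_k` -/

/-- `Tfin k`: the good sets of size `≤ k` (the index set of the basis `T_k` of `Ŝ_k`)
[cite: KrajicekProofComplexity2019, §16.2 (pp. 333–336)] -/
def Tfin (m n k : ℕ) : Finset (Finset (Fin m × Fin n)) :=
  Finset.univ.filter fun ρ => Good ρ ∧ ρ.card ≤ k

/-- Membership in `Tfin`. [folklore] -/
theorem mem_Tfin {k : ℕ} {ρ : Finset (Fin m × Fin n)} : ρ ∈ Tfin m n k ↔ Good ρ ∧ ρ.card ≤ k := by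
  simp [Tfin]

/-- `N k = Ŝ_k`: vectors supported on good sets of size `≤ k`
[cite: KrajicekProofComplexity2019, §16.2 (pp. 333–336)] -/
noncomputable def N (k : ℕ) : Submodule F (Vec m n F) :=
  Finsupp.supported F F (↑(Tfin m n k) : Set (Finset (Fin m × Fin n)))

/-- Membership in `Ŝ_k`. [folklore] -/
theorem mem_N {k : ℕ} {v : Vec m n F} : v ∈ N k ↔ ∀ ρ ∈ v.support, Good ρ ∧ ρ.card ≤ k := by
  unfold N
  rw [Finsupp.mem_supported]
  constructor
  · intro h ρ hρ; exact mem_Tfin.mp (h hρ)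
  · intro h ρ hρ; exact mem_Tfin.mpr (h ρ hρ)

/-- The basis vectors `x_ρ`, `|ρ| ≤ k`, lie in `Ŝ_k`. [folklore] -/
theorem single_mem_N {k : ℕ} {ρ : Finset (Fin m × Fin n)} (hg : Good ρ) (hk : ρ.card ≤ k)
    (a : F) : Finsupp.single ρ a ∈ N k := by
  rw [mem_N]
  intro ρ' hρ'
  have := Finsupp.support_single_subset hρ'
  rw [Finset.mem_singleton] at this
  subst this
  exact ⟨hg, hk⟩

/-- The degree filtration `Ŝ_k` is increasing in `k`. [folklore] -/
theorem N_mono {k k' : ℕ} (h : k ≤ k') : N (F := F) (m := m) (n := n) k ≤ N k' := by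
  intro v hv
  rw [mem_N] at hv ⊢
  exact fun ρ hρ => ⟨(hv ρ hρ).1, (hv ρ hρ).2.trans h⟩

/-- `Ŝ_k` is spanned by `T_k = {x_ρ : |ρ| ≤ k}`. [cite: KrajicekProofComplexity2019, §16.2 (pp.
333–336)] -/
theorem N_eq_span (k : ℕ) :
    N (F := F) k = Submodule.span F
      ((fun ρ => Finsupp.single ρ (1 : F)) '' (↑(Tfin m n k) : Set (Finset (Fin m × Fin n)))) :=
  Finsupp.supported_eq_span_single F _

/-- a linear map sending the basis vectors of `Ŝ_k` into a submodule maps `Ŝ_k` into it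
[folklore] -/
theorem N_le_comap {k : ℕ} (f : Module.End F (Vec m n F)) (P : Submodule F (Vec m n F))
    (hf : ∀ ρ, Good ρ → ρ.card ≤ k → f (Finsupp.single ρ 1) ∈ P) : N k ≤ P.comap f := by
  rw [N_eq_span, Submodule.span_le]
  rintro _ ⟨ρ, hρ, rfl⟩
  rw [Finset.mem_coe, mem_Tfin] at hρ
  exact hf ρ hρ.1 hρ.2

/-- `x_p · Ŝ_k ⊆ Ŝ_{k+1}`. [folklore] -/
theorem mulVar_mem_N {k : ℕ} (p : Fin m × Fin n) {v : Vec m n F} (hv : v ∈ N k) :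
    mulVar p v ∈ N (k + 1) := by
  refine N_le_comap (mulVar p) (N (k + 1)) (fun ρ hg hk => ?_) hv
  rw [mulVar_single]
  split_ifs with h
  · exact single_mem_N h ((Finset.card_insert_le _ _).trans (by omega)) _
  · exact zero_mem _

/-- `Q_i · Ŝ_k ⊆ Ŝ_{k+1}`. [folklore] -/
theorem Qop_mem_N {k : ℕ} (i : Fin m) {v : Vec m n F} (hv : v ∈ N k) : Qop i v ∈ N (k + 1) := by
  rw [Qop_apply]
  exact sub_mem (N_mono (Nat.le_succ k) hv) (sum_mem fun j _ => mulVar_mem_N _ hv)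

/-- `x_α ∏_{i ∈ Z} Q_i ∈ Ŝ_{|α| + |Z|}` (it has degree `|α| + |Z|`). [cite:
KrajicekProofComplexity2019, §16.2 (pp. 333–336)] -/
theorem bvec_mem_N {α : Finset (Fin m × Fin n)} (hg : Good α) (Z : Finset (Fin m)) :
    bvec (F := F) α Z ∈ N (α.card + Z.card) := by
  induction Z using Finset.induction_on with
  | empty => simpa [bvec_empty] using single_mem_N hg le_rfl (1 : F)
  | insert i Z hi ih =>
    rw [bvec_insert hi, Finset.card_insert_of_notMem hi, ← add_assoc]
    exact Qop_mem_N i ih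

/-! ### Admissible pairs `(α, Z)` (Krajíček's `B_t = C_t ∪ Δ_t`) and the spanning claim -/

/-- the pigeons of `ρ`, in increasing order
[cite: KrajicekProofComplexity2019, §16.2 (pp. 333–336)] -/
def pigeons (ρ : Finset (Fin m × Fin n)) : List (Fin m) := (dom ρ).sort (· ≤ ·)

/-- Membership in `pigeons`. [folklore] -/
theorem mem_pigeons {ρ : Finset (Fin m × Fin n)} {i : Fin m} : i ∈ pigeons ρ ↔ i ∈ dom ρ := by
  simp [pigeons]

/-- `pigeons ρ` is strictly increasing. [folklore] -/
theorem pigeons_pairwise (ρ : Finset (Fin m × Fin n)) : (pigeons ρ).Pairwise (· < ·) :=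
  List.sortedLT_iff_pairwise.mp (Finset.sortedLT_sort _)

/-- `pigeons ρ` has no duplicates. [folklore] -/
theorem pigeons_nodup (ρ : Finset (Fin m × Fin n)) : (pigeons ρ).Nodup :=
  Finset.sort_nodup _ _

/-- `AdmP k (α, Z)`: `α` is a partial injection on which the pigeon dance is defined, `Z` a set of
further pigeons ("mapped to `0`"), and `|α| + |Z| ≤ k` — the index set of Krajíček's `B_k`
(`Z = ∅` gives `Δ_k`, `Z ≠ ∅` gives `C_k`).
[cite: KrajicekProofComplexity2019, §16.2 (pp. 333–336)] -/
def AdmP (k : ℕ) (x : Finset (Fin m × Fin n) × Finset (Fin m)) : Prop :=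
  Good x.1 ∧ Disjoint x.2 (dom x.1) ∧ x.1.card + x.2.card ≤ k ∧ CanDance x.1 (pigeons x.1)

/-- Decidability of `AdmP`. [folklore] -/
instance (k : ℕ) : DecidablePred (AdmP (m := m) (n := n) k) := fun x => by
  unfold AdmP; infer_instance

/-- the index set of `B_k` as a set [cite: KrajicekProofComplexity2019, §16.2 (pp. 333–336)] -/
def Adm (m n k : ℕ) : Set (Finset (Fin m × Fin n) × Finset (Fin m)) := {x | AdmP k x}

/-- the index set of `C_k` [cite: KrajicekProofComplexity2019, §16.2 (pp. 333–336)] -/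
def AdmC (m n k : ℕ) : Set (Finset (Fin m × Fin n) × Finset (Fin m)) :=
  {x | AdmP k x ∧ x.2.Nonempty}

/-- `B_k ⊆ B_{k'}` for `k ≤ k'`. [folklore] -/
theorem Adm_mono {k k' : ℕ} (h : k ≤ k') : Adm m n k ⊆ Adm m n k' :=
  fun _ hx => ⟨hx.1, hx.2.1, hx.2.2.1.trans h, hx.2.2.2⟩

/-- `C_k ⊆ C_{k'}` for `k ≤ k'`. [folklore] -/
theorem AdmC_mono {k k' : ℕ} (h : k ≤ k') : AdmC m n k ⊆ AdmC m n k' :=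
  fun _ hx => ⟨Adm_mono h hx.1, hx.2⟩

/-- `C_k ⊆ B_k`. [folklore] -/
theorem AdmC_subset_Adm (k : ℕ) : AdmC m n k ⊆ Adm m n k := fun _ hx => hx.1

/-- the vector `x_α ∏_{i ∈ Z} Q_i` attached to the pair `(α, Z)`
[cite: KrajicekProofComplexity2019, §16.2 (pp. 333–336)] -/
noncomputable def bv (x : Finset (Fin m × Fin n) × Finset (Fin m)) : Vec m n F := bvec x.1 x.2

/-- `SA k = F · B_k` [cite: KrajicekProofComplexity2019, §16.2 (pp. 333–336)] -/
noncomputable def SA (k : ℕ) : Submodule F (Vec m n F) := Submodule.span F (bv '' Adm m n k)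

/-- `W k = F · C_k` (this will be the space of degree-`≤ k` consequences)
[cite: KrajicekProofComplexity2019, §16.2 (pp. 333–336)] -/
noncomputable def W (k : ℕ) : Submodule F (Vec m n F) := Submodule.span F (bv '' AdmC m n k)

/-- `F·B_k ⊆ F·B_{k'}` for `k ≤ k'`. [folklore] -/
theorem SA_mono {k k' : ℕ} (h : k ≤ k') : SA (F := F) (m := m) (n := n) k ≤ SA k' :=
  Submodule.span_mono (Set.image_mono (Adm_mono h))

/-- `F·C_k ⊆ F·C_{k'}` for `k ≤ k'`. [folklore] -/
theorem W_mono {k k' : ℕ} (h : k ≤ k') : W (F := F) (m := m) (n := n) k ≤ W k' :=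
  Submodule.span_mono (Set.image_mono (AdmC_mono h))

/-- `F·C_k ⊆ F·B_k`. [folklore] -/
theorem W_le_SA (k : ℕ) : W (F := F) (m := m) (n := n) k ≤ SA k :=
  Submodule.span_mono (Set.image_mono (AdmC_subset_Adm k))

/-- The elements of `B_k` lie in `F·B_k`. [folklore] -/
theorem bv_mem_SA {k : ℕ} {x : Finset (Fin m × Fin n) × Finset (Fin m)} (hx : x ∈ Adm m n k) :
    bv (F := F) x ∈ SA k :=
  Submodule.subset_span ⟨x, hx, rfl⟩

/-- The elements of `C_k` lie in `F·C_k`. [folklore] -/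
theorem bv_mem_W {k : ℕ} {x : Finset (Fin m × Fin n) × Finset (Fin m)} (hx : x ∈ AdmC m n k) :
    bv (F := F) x ∈ W k :=
  Submodule.subset_span ⟨x, hx, rfl⟩

/-- the action of `Q_i` on a basis vector: zero, or a `C`-vector one level up (Krajíček 2019,
proof of Lemma 16.2.2: closure of `F · C_t` under the rules)
[cite: KrajicekProofComplexity2019, §16.2 (pp. 333–336)] -/
theorem Qop_bv_cases {k : ℕ} {x : Finset (Fin m × Fin n) × Finset (Fin m)} (hx : x ∈ Adm m n k)
    (i : Fin m) :
    Qop i (bv (F := F) x) = 0 ∨ ∃ y, y ∈ AdmC m n (k + 1) ∧ Qop i (bv (F := F) x) = bv y := by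
  obtain ⟨hg, hdisj, hcard, hcan⟩ := hx
  by_cases h1 : i ∈ dom x.1
  · exact Or.inl (Qop_bvec_of_mem_dom hg h1)
  by_cases h2 : i ∈ x.2
  · exact Or.inr ⟨x, ⟨⟨hg, hdisj, hcard.trans (Nat.le_succ k), hcan⟩, ⟨i, h2⟩⟩,
      Qop_bvec_of_mem_Z h2⟩
  · refine Or.inr ⟨(x.1, insert i x.2), ⟨⟨hg, ?_, ?_, hcan⟩, ⟨i, Finset.mem_insert_self _ _⟩⟩,
      (bvec_insert h2).symm⟩
    · exact Finset.disjoint_insert_left.mpr ⟨h1, hdisj⟩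
    · simp only [Finset.card_insert_of_notMem h2]
      omega

/-- `Q_i · (F·B_k) ⊆ F·C_{k+1}`. [cite: KrajicekProofComplexity2019, §16.2 (pp. 333–336)] -/
theorem Qop_mem_W_succ {k : ℕ} {v : Vec m n F} (hv : v ∈ SA k) (i : Fin m) :
    Qop i v ∈ W (k + 1) := by
  have : SA (F := F) (m := m) (n := n) k ≤ (W (k + 1)).comap (Qop i) := by
    rw [SA, Submodule.span_le]
    rintro _ ⟨x, hx, rfl⟩
    simp only [SetLike.mem_coe, Submodule.mem_comap]
    rcases Qop_bv_cases (F := F) hx i with h0 | ⟨y, hy, hyeq⟩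
    · rw [h0]; exact zero_mem _
    · rw [hyeq]; exact bv_mem_W hy
  exact this hv

/-! #### The colexicographic key used for the induction in Claim 1 -/

/-- hole of pigeon `i` in `ρ`, plus one (`0` if absent; a sum, single-valued for good `ρ`)
[cite: KrajicekProofComplexity2019, §16.2, proof of Lemma 16.2.2 (Claim 1, p. 335)] -/
def digit (ρ : Finset (Fin m × Fin n)) (i : Fin m) : ℕ :=
  ∑ p ∈ ρ.filter (fun p => p.1 = i), (p.2.val + 1)

/-- the key: digits compared from the largest pigeon down (Krajíček's ordering `≺` on monomials
of equal degree: "for the largest `w` such that `j_w ≠ v_w` it holds that `j_w < v_w`")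
[cite: KrajicekProofComplexity2019, §16.2, proof of Lemma 16.2.2 (Claim 1, p. 335)] -/
def ckey (ρ : Finset (Fin m × Fin n)) : Colex (Fin m → ℕ) := toColex (digit ρ)

/-- The digit of pigeon `i` depends only on the pairs of pigeon `i`. [folklore] -/
theorem digit_congr {ρ₁ ρ₂ : Finset (Fin m × Fin n)} {i : Fin m}
    (h : ∀ p : Fin m × Fin n, p.1 = i → (p ∈ ρ₁ ↔ p ∈ ρ₂)) : digit ρ₁ i = digit ρ₂ i := by
  unfold digit
  congr 1
  ext p
  simp only [Finset.mem_filter]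
  constructor
  · rintro ⟨hp, hpi⟩; exact ⟨(h p hpi).mp hp, hpi⟩
  · rintro ⟨hp, hpi⟩; exact ⟨(h p hpi).mpr hp, hpi⟩

/-- The digit of a placed pigeon. [folklore] -/
theorem digit_eq {ρ : Finset (Fin m × Fin n)} {i : Fin m} {j : Fin n} (hmem : (i, j) ∈ ρ)
    (huniq : ∀ j', (i, j') ∈ ρ → j' = j) : digit ρ i = j.val + 1 := by
  unfold digit
  rw [show ρ.filter (fun p => p.1 = i) = {(i, j)} from ?_, Finset.sum_singleton]
  ext ⟨a, b⟩
  simp only [Finset.mem_filter, Finset.mem_singleton, Prod.mk.injEq]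
  constructor
  · rintro ⟨hab, rfl⟩; exact ⟨rfl, huniq b hab⟩
  · rintro ⟨rfl, rfl⟩; exact ⟨hmem, rfl⟩

/-- Comparison of keys: agreement above pigeon `i` and a smaller digit at `i` (Krajíček's ordering
`≺`: "for the largest `w` such that `j_w ≠ v_w`, `j_w < v_w`"). [cite: KrajicekProofComplexity2019,
§16.2, proof of Lemma 16.2.2 (Claim 1, p. 335)] -/
theorem ckey_lt {ρ₁ ρ₂ : Finset (Fin m × Fin n)} {i : Fin m}
    (hagree : ∀ p : Fin m × Fin n, i < p.1 → (p ∈ ρ₁ ↔ p ∈ ρ₂))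
    (hlt : digit ρ₁ i < digit ρ₂ i) : ckey ρ₁ < ckey ρ₂ :=
  ⟨i, fun _ hj => digit_congr fun p hp => hagree p (hp ▸ hj), hlt⟩

/-- Moving pigeon `i` forgets a previously inserted pair of pigeon `i`. [folklore] -/
theorem move_insert_self (s : Finset (Fin m × Fin n)) (i : Fin m) (j h : Fin n) :
    move (insert (i, j) s) i h = move s i h := by
  ext p
  simp only [mem_move, Finset.mem_insert]
  constructor
  · rintro (rfl | ⟨rfl | hp, hpi⟩)
    · exact Or.inl rfl
    · exact absurd rfl hpi
    · exact Or.inr ⟨hp, hpi⟩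
  · rintro (rfl | ⟨hp, hpi⟩)
    · exact Or.inl rfl
    · exact Or.inr ⟨Or.inr hp, hpi⟩

/-- **Claim 1, inductive step along the attempted dances** (Krajíček 2019, proof of Lemma 16.2.2,
Claim 1): if no dance of the remaining pigeons `L` completes from `δ` (a state reached from `γ`
by dancing the earlier pigeons), then `x_δ ∈ F · B_{|γ|}`, given the claim for all monomials
below `x_γ`. [cite: KrajicekProofComplexity2019, §16.2, proof of Lemma 16.2.2 (Claim 1, p. 335)] -/
theorem claim1_branch (γ : Finset (Fin m × Fin n)) (hγ : Good γ)
    (Hlt : ∀ δ : Finset (Fin m × Fin n), Good δ → δ.card < γ.card →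
      Finsupp.single δ (1 : F) ∈ SA δ.card)
    (Hlex : ∀ δ : Finset (Fin m × Fin n), Good δ → δ.card = γ.card → ckey δ < ckey γ →
      Finsupp.single δ (1 : F) ∈ SA γ.card) :
    ∀ (L : List (Fin m)) (δ : Finset (Fin m × Fin n)), L.Pairwise (· < ·) →
      (∀ i ∈ L, i ∈ dom γ) → Good δ → δ.card = γ.card →
      (∀ p : Fin m × Fin n, (∃ i ∈ L, i ≤ p.1) → (p ∈ δ ↔ p ∈ γ)) →
      ¬ CanDance δ L → Finsupp.single δ (1 : F) ∈ SA γ.card := by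
  intro L
  induction L with
  | nil => intro δ _ _ _ _ _ hcan; exact absurd trivial hcan
  | cons i L ih =>
    intro δ hsort hdom hδ hcard hagree hcan
    have hiL : ∀ i' ∈ L, i < i' := (List.pairwise_cons.mp hsort).1
    have hsortL : L.Pairwise (· < ·) := (List.pairwise_cons.mp hsort).2
    obtain ⟨j₀, hj₀γ⟩ := mem_dom.mp (hdom i List.mem_cons_self)
    have hj₀δ : (i, j₀) ∈ δ := (hagree (i, j₀) ⟨i, List.mem_cons_self, le_rfl⟩).mpr hj₀γ
    set δ' := δ.erase (i, j₀) with hδ'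
    have hgδ' : Good δ' := hδ.subset (Finset.erase_subset _ _)
    have hiδ' : i ∉ dom δ' := by
      intro hm
      obtain ⟨j, hj⟩ := mem_dom.mp hm
      have hj' := Finset.mem_erase.mp hj
      exact hj'.1 (by rw [hδ.eq_of_fst hj'.2 hj₀δ])
    have hins : insert (i, j₀) δ' = δ := Finset.insert_erase hj₀δ
    have hcard' : δ'.card + 1 = γ.card := by rw [← hcard, hδ', Finset.card_erase_add_one hj₀δ]
    have hj₀free : j₀ ∉ ran δ' := by
      intro hm
      obtain ⟨q, hq⟩ := mem_ran.mp hm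
      have hq' := Finset.mem_erase.mp hq
      exact hq'.1 (by rw [hδ.eq_of_snd hq'.2 hj₀δ])
    -- agreement above pigeon `i` for the modified states
    have hagree' : ∀ (h' : Fin n) (p : Fin m × Fin n), i < p.1 →
        (p ∈ insert (i, h') δ' ↔ p ∈ γ) := by
      intro h' p hp
      have hpi : p.1 ≠ i := ne_of_gt hp
      rw [Finset.mem_insert, hδ', Finset.mem_erase]
      constructor
      · rintro (rfl | ⟨_, hp'⟩)
        · exact absurd rfl hpi
        · exact (hagree p ⟨i, List.mem_cons_self, hp.le⟩).mp hp'
      · intro hpγ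
        refine Or.inr ⟨fun he => hpi (by rw [he]), ?_⟩
        exact (hagree p ⟨i, List.mem_cons_self, hp.le⟩).mpr hpγ
    -- the expansion identity for `x_δ`
    have hexp := Qop_single_of_notMem (F := F) hgδ' hiδ' (1 : F)
    have hj₀A : j₀ ∈ freeH δ' := mem_freeH.mpr hj₀free
    rw [← Finset.add_sum_erase _ _ hj₀A, hins] at hexp
    have heq : Finsupp.single δ (1 : F) = Finsupp.single δ' 1 - Qop i (Finsupp.single δ' 1) -
        ∑ h ∈ (freeH δ').erase j₀, Finsupp.single (insert (i, h) δ') 1 := by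
      rw [hexp]; abel
    rw [heq]
    have hδ'SA : Finsupp.single δ' (1 : F) ∈ SA δ'.card := Hlt δ' hgδ' (by omega)
    refine sub_mem (sub_mem (SA_mono (by omega) hδ'SA) ?_) (sum_mem fun h hh => ?_)
    · have := Qop_mem_W_succ hδ'SA i
      rw [hcard'] at this
      exact W_le_SA _ this
    · obtain ⟨hhj₀, hhA⟩ := Finset.mem_erase.mp hh
      rw [mem_freeH] at hhA
      have hgρ : Good (insert (i, h) δ') := good_insert hgδ' hiδ' hhA
      have hcardρ : (insert (i, h) δ').card = γ.card := by
        rw [Finset.card_insert_of_notMem (fun hm => hiδ' (mem_dom.mpr ⟨h, hm⟩)), hcard']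
      rcases lt_or_gt_of_ne hhj₀ with hlt | hgt
      · -- `h < j₀`: the new monomial is below `x_γ` in the colex order
        refine Hlex _ hgρ hcardρ (ckey_lt (i := i) (hagree' h) ?_)
        rw [digit_eq (Finset.mem_insert_self _ _) ?_, digit_eq hj₀γ ?_]
        · simpa using hlt
        · intro j' hj'
          exact hγ.eq_of_fst hj' hj₀γ
        · intro j' hj'
          rcases Finset.mem_insert.mp hj' with he | hm
          · simpa using he
          · exact absurd (mem_dom.mpr ⟨j', hm⟩) hiδ'
      · -- `h > j₀`: a legal dance step of pigeon `i`; recurse on the remaining pigeons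
        refine ih _ hsortL (fun i' hi' => hdom i' (List.mem_cons_of_mem _ hi')) hgρ hcardρ ?_ ?_
        · rintro p ⟨i', hi'L, hi'p⟩
          exact hagree' h p ((hiL i' hi'L).trans_le hi'p)
        · intro hcanρ
          apply hcan
          refine ⟨h, ⟨?_, ?_⟩, ?_⟩
          · intro hm
            obtain ⟨q, hq⟩ := mem_ran.mp hm
            rw [← hins, Finset.mem_insert] at hq
            rcases hq with he | hq
            · simp only [Prod.mk.injEq] at he
              exact (ne_of_gt hgt) he.2
            · exact hhA (mem_ran.mpr ⟨q, hq⟩)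
          · intro j hj
            rw [hδ.eq_of_fst hj hj₀δ]
            exact hgt
          · rw [← hins, move_insert_self, move_of_notMem_dom h hiδ']
            exact hcanρ

/-- **Claim 1** (Krajíček 2019, proof of Lemma 16.2.2): every monomial `x_γ` (`γ` a partial
injection) lies in the span of `B_{|γ|}`.
[cite: KrajicekProofComplexity2019, §16.2, proof of Lemma 16.2.2 (Claim 1, p. 335)] -/
theorem claim1 (γ : Finset (Fin m × Fin n)) (hγ : Good γ) :
    Finsupp.single γ (1 : F) ∈ SA γ.card := by
  revert hγ
  refine (InvImage.wf (fun ρ : Finset (Fin m × Fin n) => toLex (ρ.card, ckey ρ))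
    (wellFounded_lt (α := ℕ ×ₗ Colex (Fin m → ℕ)))).induction γ
    (C := fun γ => Good γ → Finsupp.single γ (1 : F) ∈ SA γ.card) ?_
  intro γ IH hγ
  by_cases hcan : CanDance γ (pigeons γ)
  · have hx : (γ, (∅ : Finset (Fin m))) ∈ Adm m n γ.card :=
      ⟨hγ, Finset.disjoint_empty_left _, by simp, hcan⟩
    have := bv_mem_SA (F := F) hx
    simpa [bv, bvec_empty] using this
  · refine claim1_branch γ hγ (fun δ hδ hlt => IH δ ?_ hδ) (fun δ hδ heq hkey => ?_) (pigeons γ) γ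
      (pigeons_pairwise γ) (fun i hi => mem_pigeons.mp hi) hγ rfl (fun p _ => Iff.rfl) hcan
    · exact Prod.Lex.toLex_lt_toLex.mpr (Or.inl hlt)
    · have := IH δ (Prod.Lex.toLex_lt_toLex.mpr (Or.inr ⟨heq, hkey⟩)) hδ
      rwa [heq] at this

/-- `F · B_k = Ŝ_k`: the admissible vectors of level `k` span exactly the degree-`≤ k` part.
[cite: KrajicekProofComplexity2019, §16.2, Lemma 16.2.2 (p. 334)] -/
theorem SA_eq_N (k : ℕ) : SA (F := F) (m := m) (n := n) k = N k := by
  apply le_antisymm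
  · rw [SA, Submodule.span_le]
    rintro _ ⟨x, hx, rfl⟩
    exact N_mono hx.2.2.1 (bvec_mem_N hx.1 x.2)
  · rw [N_eq_span, Submodule.span_le]
    rintro _ ⟨ρ, hρ, rfl⟩
    rw [Finset.mem_coe, mem_Tfin] at hρ
    exact SA_mono hρ.2 (claim1 ρ hρ.1)

end Alg

/-! ### Claim 2: the map `D` (minimal dance of all pigeons of `(α, Z)`) and its injectivity -/

section Dmap

/-- the processing list of `(α, Z)`: all its pigeons, increasing
[cite: KrajicekProofComplexity2019, §16.2, proof of Lemma 16.2.2 (Claim 2, pp. 335–336)] -/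
def plist (x : Finset (Fin m × Fin n) × Finset (Fin m)) : List (Fin m) :=
  (dom x.1 ∪ x.2).sort (· ≤ ·)

/-- Krajíček's map `D : B_t → T_t`: the minimal pigeon dance applied, in increasing order, to all
pigeons of `α` and of `Z` (the latter "sitting at hole `0`", i.e. below every hole).
[cite: KrajicekProofComplexity2019, §16.2, proof of Lemma 16.2.2 (Claim 2, pp. 335–336)] -/
def Dmap (x : Finset (Fin m × Fin n) × Finset (Fin m)) : Finset (Fin m × Fin n) :=
  (minDance x.1 (plist x)).getD ∅

/-- The processing list has no duplicates. [folklore] -/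
theorem plist_nodup (x : Finset (Fin m × Fin n) × Finset (Fin m)) : (plist x).Nodup :=
  Finset.sort_nodup _ _

/-- The pigeons of `α` within the processing list of `(α, Z)`, in order, are `pigeons α`.
[folklore] -/
theorem plist_filter (x : Finset (Fin m × Fin n) × Finset (Fin m)) :
    (plist x).filter (fun i => decide (i ∈ dom x.1)) = pigeons x.1 := by
  apply List.Pairwise.eq_of_mem_iff (r := (· < ·))
  · exact List.Pairwise.filter _ (List.sortedLT_iff_pairwise.mp (Finset.sortedLT_sort _))
  · exact pigeons_pairwise _
  · intro a
    simp only [plist, List.mem_filter, Finset.mem_sort, Finset.mem_union, decide_eq_true_eq,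
      mem_pigeons]
    tauto

/-- **Claim 2** (Krajíček 2019): for `(α, Z) ∈ B_k` with `2k ≤ n`, all pigeons of `α` and `Z`
can dance (so the minimal dance `D` is defined).
[cite: KrajicekProofComplexity2019, §16.2, proof of Lemma 16.2.2 (Claim 2, pp. 335–336)] -/
theorem canDance_plist {k : ℕ} {x : Finset (Fin m × Fin n) × Finset (Fin m)} (hx : x ∈ Adm m n k)
    (hk : 2 * k ≤ n) : CanDance x.1 (plist x) := by
  obtain ⟨hg, hdisj, hcard, hcan⟩ := hx
  refine canDance_of_filter (fun i => i ∈ dom x.1) (plist x) x.1 (plist_nodup x)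
    (fun i _ h => h) ?_ ?_
  · have h1 : (plist x).length ≤ (dom x.1).card + x.2.card := by
      rw [plist, Finset.length_sort]
      exact Finset.card_union_le _ _
    rw [hg.card_dom] at h1
    rw [hg.card_ran]
    omega
  · rw [plist_filter]
    exact hcan

/-- `D` is defined on `B_k` for `2k ≤ n` (Claim 2). [cite: KrajicekProofComplexity2019, §16.2,
proof of Lemma 16.2.2 (Claim 2, pp. 335–336)] -/
theorem Dmap_spec {k : ℕ} {x : Finset (Fin m × Fin n) × Finset (Fin m)} (hx : x ∈ Adm m n k)
    (hk : 2 * k ≤ n) : minDance x.1 (plist x) = some (Dmap x) := by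
  have h := minDance_isSome_of_canDance (plist x) x.1 (plist_nodup x) (canDance_plist hx hk)
  obtain ⟨r, hr⟩ := Option.isSome_iff_exists.mp h
  rw [Dmap, hr]
  rfl

/-- The pigeons placed by `D(α, Z)` are those of `α` and of `Z`. [cite:
KrajicekProofComplexity2019, §16.2, proof of Lemma 16.2.2 (Claim 2, pp. 335–336)] -/
theorem dom_Dmap {k : ℕ} {x : Finset (Fin m × Fin n) × Finset (Fin m)} (hx : x ∈ Adm m n k)
    (hk : 2 * k ≤ n) : dom (Dmap x) = dom x.1 ∪ x.2 := by
  rw [minDance_dom (plist_nodup x) (Dmap_spec hx hk)]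
  ext i
  simp [plist, Finset.mem_union]

/-- `D` maps `B_k` into `T_k` (`2k ≤ n`). [cite: KrajicekProofComplexity2019, §16.2, proof of Lemma
16.2.2 (Claim 3, p. 336)] -/
theorem Dmap_mem_Tfin {k : ℕ} {x : Finset (Fin m × Fin n) × Finset (Fin m)} (hx : x ∈ Adm m n k)
    (hk : 2 * k ≤ n) : Dmap x ∈ Tfin m n k := by
  have hr := Dmap_spec hx hk
  have hgood : Good (Dmap x) := minDance_good _ _ _ hx.1 hr
  rw [mem_Tfin]
  refine ⟨hgood, ?_⟩
  rw [← hgood.card_dom, dom_Dmap hx hk]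
  calc (dom x.1 ∪ x.2).card ≤ (dom x.1).card + x.2.card := Finset.card_union_le _ _
    _ = x.1.card + x.2.card := by rw [hx.1.card_dom]
    _ ≤ k := hx.2.2.1

/-- **Claim 3** (Krajíček 2019): `D` is injective on `B_k` (`2k ≤ n`).
[cite: KrajicekProofComplexity2019, §16.2, proof of Lemma 16.2.2 (Claim 3, p. 336)] -/
theorem Dmap_injOn {k : ℕ} (hk : 2 * k ≤ n) : Set.InjOn (Dmap (m := m) (n := n)) (Adm m n k) := by
  intro x hx y hy hxy
  have hU : dom x.1 ∪ x.2 = dom y.1 ∪ y.2 := by rw [← dom_Dmap hx hk, ← dom_Dmap hy hk, hxy]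
  have hL : plist x = plist y := by simp only [plist, hU]
  have h1 : x.1 = y.1 := by
    refine minDance_injective (plist x) x.1 y.1 (Dmap x) hx.1 hy.1 (Dmap_spec hx hk) ?_
    rw [hL, hxy]
    exact Dmap_spec hy hk
  have h2 : x.2 = y.2 := by
    rw [← Finset.union_sdiff_cancel_left hx.2.1.symm, ← Finset.union_sdiff_cancel_left hy.2.1.symm,
      hU, h1]
  exact Prod.ext h1 h2

/-- the finite index set of `B_k` [cite: KrajicekProofComplexity2019, §16.2 (pp. 333–336)] -/
def AdmF (m n k : ℕ) : Finset (Finset (Fin m × Fin n) × Finset (Fin m)) :=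
  Finset.univ.filter (AdmP k)

/-- Membership in `AdmF`. [folklore] -/
theorem mem_AdmF {k : ℕ} {x : Finset (Fin m × Fin n) × Finset (Fin m)} :
    x ∈ AdmF m n k ↔ x ∈ Adm m n k := by
  simp [AdmF, Adm]

/-- `AdmF` is the finite version of `Adm`. [folklore] -/
theorem coe_AdmF (k : ℕ) : (↑(AdmF m n k) : Set _) = Adm m n k := by
  ext x; exact mem_AdmF

/-- `|B_k| ≤ |T_k|` for `2k ≤ n`
[cite: KrajicekProofComplexity2019, §16.2, proof of Lemma 16.2.2 (Claim 3, p. 336)] -/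
theorem card_AdmF_le {k : ℕ} (hk : 2 * k ≤ n) : (AdmF m n k).card ≤ (Tfin m n k).card := by
  refine Finset.card_le_card_of_injOn Dmap (fun x hx => ?_) ?_
  · rw [coe_AdmF] at hx
    exact Dmap_mem_Tfin hx hk
  · rw [coe_AdmF]
    exact Dmap_injOn hk

end Dmap

/-! ### Linear independence of `B_k` (`2k ≤ n`) and the two key closure facts -/

section LinAlg

variable (F : Type*) [Field F]

/-- the family `B_k` indexed by the finite type `AdmF`
[cite: KrajicekProofComplexity2019, §16.2 (pp. 333–336)] -/
noncomputable def bfam (k : ℕ) : ↥(AdmF m n k) → Vec m n F := fun x => bv x.1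

variable {F}

/-- `dim Ŝ_k = |T_k|`. [cite: KrajicekProofComplexity2019, §16.2 (pp. 333–336)] -/
theorem finrank_N (k : ℕ) :
    Module.finrank F (N (F := F) (m := m) (n := n) k) = (Tfin m n k).card := by
  unfold N
  rw [(Finsupp.supportedEquivFinsupp (R := F) (M := F)
    (↑(Tfin m n k) : Set (Finset (Fin m × Fin n)))).finrank_eq, Module.finrank_finsupp_self]
  simp

/-- The range of the family `bfam` is `B_k`. [folklore] -/
theorem range_bfam (k : ℕ) : Set.range (bfam (m := m) (n := n) F k) = bv '' Adm m n k := by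
  ext v
  constructor
  · rintro ⟨x, rfl⟩
    exact ⟨x.1, mem_AdmF.mp x.2, rfl⟩
  · rintro ⟨x, hx, rfl⟩
    exact ⟨⟨x, mem_AdmF.mpr hx⟩, rfl⟩

/-- **`B_k` is linearly independent for `2k ≤ n`** (Krajíček 2019, Lemma 16.2.2: it spans `Ŝ_k`
and `|B_k| ≤ |T_k| = dim Ŝ_k`). [cite: KrajicekProofComplexity2019, §16.2, Lemma 16.2.2 (p. 334)] -/
theorem linearIndependent_bfam {k : ℕ} (hk : 2 * k ≤ n) :
    LinearIndependent F (bfam (m := m) (n := n) F k) := by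
  rw [linearIndependent_iff_card_le_finrank_span]
  have : Set.finrank F (Set.range (bfam (m := m) (n := n) F k)) = (Tfin m n k).card := by
    rw [Set.finrank, range_bfam]
    change Module.finrank F (SA (F := F) (m := m) (n := n) k) = _
    rw [SA_eq_N, finrank_N]
  rw [this, Fintype.card_coe]
  exact card_AdmF_le hk

/-- the index set of `Δ_k` [cite: KrajicekProofComplexity2019, §16.2 (pp. 333–336)] -/
def AdmD (m n k : ℕ) : Set (Finset (Fin m × Fin n) × Finset (Fin m)) :=
  {x | AdmP k x ∧ x.2 = ∅}

/-- `Δ_k ⊆ Δ_{k'}` for `k ≤ k'`. [folklore] -/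
theorem AdmD_mono {k k' : ℕ} (h : k ≤ k') : AdmD m n k ⊆ AdmD m n k' :=
  fun _ hx => ⟨Adm_mono h hx.1, hx.2⟩

/-- The `C`-part of the family `bfam`. [folklore] -/
theorem image_bfam_C (k : ℕ) :
    bfam (m := m) (n := n) F k '' {x | x.1.2.Nonempty} = bv '' AdmC m n k := by
  ext v
  constructor
  · rintro ⟨x, hx, rfl⟩
    exact ⟨x.1, ⟨mem_AdmF.mp x.2, hx⟩, rfl⟩
  · rintro ⟨x, hx, rfl⟩
    exact ⟨⟨x, mem_AdmF.mpr hx.1⟩, hx.2, rfl⟩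

/-- The `Δ`-part of the family `bfam`. [folklore] -/
theorem image_bfam_D (k : ℕ) :
    bfam (m := m) (n := n) F k '' {x | x.1.2 = ∅} = bv '' AdmD m n k := by
  ext v
  constructor
  · rintro ⟨x, hx, rfl⟩
    exact ⟨x.1, ⟨mem_AdmF.mp x.2, hx⟩, rfl⟩
  · rintro ⟨x, hx, rfl⟩
    exact ⟨⟨x, mem_AdmF.mpr hx.1⟩, hx.2, rfl⟩

/-- `F·C_k ∩ F·Δ_k = 0` for `2k ≤ n` (from the linear independence of `B_k`). [cite:
KrajicekProofComplexity2019, §16.2, Lemma 16.2.2 (p. 334)] -/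
theorem disjoint_W_spanD {k : ℕ} (hk : 2 * k ≤ n) :
    Disjoint (W (F := F) (m := m) (n := n) k) (Submodule.span F (bv '' AdmD m n k)) := by
  have h := (linearIndependent_bfam (m := m) (n := n) (F := F) hk).disjoint_span_image
    (s := {x : ↥(AdmF m n k) | x.1.2.Nonempty}) (t := {x | x.1.2 = ∅})
    (by
      rw [Set.disjoint_left]
      intro x hx h0
      simp only [Set.mem_setOf_eq] at hx h0
      exact hx.ne_empty h0)
  rwa [image_bfam_C, image_bfam_D] at h

/-- `B_k = C_k ∪ Δ_k`. [cite: KrajicekProofComplexity2019, §16.2 (pp. 333–336)] -/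
theorem Adm_eq_union (k : ℕ) : Adm m n k = AdmC m n k ∪ AdmD m n k := by
  ext x
  simp only [Adm, AdmC, AdmD, Set.mem_setOf_eq, Set.mem_union]
  constructor
  · intro hx
    rcases x.2.eq_empty_or_nonempty with h | h
    · exact Or.inr ⟨hx, h⟩
    · exact Or.inl ⟨hx, h⟩
  · rintro (⟨hx, _⟩ | ⟨hx, _⟩) <;> exact hx

/-- `F·B_k = F·C_k + F·Δ_k`. [cite: KrajicekProofComplexity2019, §16.2, Lemma 16.2.2 (p. 334)] -/
theorem SA_eq_W_sup (k : ℕ) :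
    SA (F := F) (m := m) (n := n) k = W k ⊔ Submodule.span F (bv '' AdmD m n k) := by
  rw [SA, W, ← Submodule.span_union, ← Set.image_union, ← Adm_eq_union]

/-- **Key fact A** (from `Ŝ_k = F·C_k ⊕ F·Δ_k` and the independence of `B_{k+1}`): an element
of `F · C_{k+1}` of degree `≤ k` already lies in `F · C_k`.
[cite: KrajicekProofComplexity2019, §16.2, Lemma 16.2.2 (p. 334)] -/
theorem keyA {k : ℕ} (hk : 2 * (k + 1) ≤ n) {v : Vec m n F} (hv : v ∈ W (k + 1)) (hvN : v ∈ N k) :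
    v ∈ W k := by
  rw [← SA_eq_N, SA_eq_W_sup, Submodule.mem_sup] at hvN
  obtain ⟨c, hc, d, hd, hcd⟩ := hvN
  have hd' : d ∈ W (k + 1) := by
    have : d = v - c := by rw [← hcd]; abel
    rw [this]
    exact sub_mem hv (W_mono (Nat.le_succ k) hc)
  have hdD : d ∈ Submodule.span F (bv '' AdmD m n (k + 1)) :=
    Submodule.span_mono (Set.image_mono (AdmD_mono (Nat.le_succ k))) hd
  have h0 : d = 0 := (Submodule.disjoint_def.mp (disjoint_W_spanD hk)) d hd' hdD
  rw [← hcd, h0, add_zero]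
  exact hc

/-- **Key fact B** (Krajíček 2019, end of the proof of Lemma 16.2.2: closure of `F·C` under the
multiplication rule): `x_p · (F · C_k) ⊆ F · C_{k+1}`.
[cite: KrajicekProofComplexity2019, §16.2, Lemma 16.2.2 (p. 334)] -/
theorem keyB {k : ℕ} (p : Fin m × Fin n) {v : Vec m n F} (hv : v ∈ W k) :
    mulVar p v ∈ W (k + 1) := by
  have : W (F := F) (m := m) (n := n) k ≤ (W (F := F) (k + 1)).comap (mulVar p) := by
    rw [W, Submodule.span_le]
    rintro _ ⟨x, ⟨hx, hne⟩, rfl⟩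
    simp only [SetLike.mem_coe, Submodule.mem_comap]
    obtain ⟨i₀, hi₀⟩ := hne
    obtain ⟨hg, hdisj, hcard, hcan⟩ := hx
    have hbv : bv (F := F) x = Qop i₀ (bvec x.1 (x.2.erase i₀)) := by
      unfold bv
      conv_lhs => rw [← Finset.insert_erase hi₀]
      rw [bvec_insert (Finset.notMem_erase _ _)]
    rw [hbv, mulVar_Qop_apply]
    have h1 : bvec (F := F) x.1 (x.2.erase i₀) ∈ N (x.1.card + (x.2.erase i₀).card) :=
      bvec_mem_N hg _
    have h2 := mulVar_mem_N p h1
    have hle : x.1.card + (x.2.erase i₀).card + 1 ≤ k := by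
      rw [Finset.card_erase_of_mem hi₀]
      have := Finset.card_pos.mpr ⟨i₀, hi₀⟩
      omega
    have h3 : mulVar p (bvec (F := F) x.1 (x.2.erase i₀)) ∈ SA k := by
      rw [SA_eq_N]
      exact N_mono hle h2
    exact Qop_mem_W_succ h3 i₀
  exact this hv

/-- `1 = x_∅ ∉ F · C_k` for `2k ≤ n` (it is the element `x_∅` of `Δ_k`, and `B_k` is linearly
independent): the heart of Theorem 16.2.1. [cite: KrajicekProofComplexity2019, Thm 16.2.1] -/
theorem single_empty_notMem_W {k : ℕ} (hk : 2 * k ≤ n) :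
    Finsupp.single (∅ : Finset (Fin m × Fin n)) (1 : F) ∉ W k := by
  have hx : ((∅ : Finset (Fin m × Fin n)), (∅ : Finset (Fin m))) ∈ AdmF m n k := by
    rw [mem_AdmF]
    refine ⟨good_empty, Finset.disjoint_empty_left _, by simp, ?_⟩
    have : pigeons (∅ : Finset (Fin m × Fin n)) = [] := by simp [pigeons, dom]
    rw [this]
    trivial
  have h := (linearIndependent_bfam (m := m) (n := n) (F := F) hk).notMem_span_image
    (s := {x : ↥(AdmF m n k) | x.1.2.Nonempty}) (x := ⟨(∅, ∅), hx⟩) (by simp)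
  rw [image_bfam_C] at h
  have e : bfam (m := m) (n := n) F k ⟨(∅, ∅), hx⟩ = Finsupp.single ∅ 1 := by
    simp [bfam, bv, bvec_empty]
  rw [e] at h
  exact h

end LinAlg

/-! ### Soundness: every PC-consequence of `¬WPHP` of degree `≤ t ≤ n/2` projects into `F·C_t` -/

section PCsound

open MvPolynomial

variable (m n : ℕ) (F : Type*) [Field F]

/-- The reduction map `F[x̄] → Ŝ` (Krajíček 2019, §16.2: `Ŝ` is `F[x̄]` modulo `x² - x`,
`Q_{i₁,i₂;j}`, `Q_{i;j₁,j₂}`): a monomial goes to `x_A`, `A` its set of variables, if `A` is a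
partial injection, and to `0` otherwise. [cite: KrajicekProofComplexity2019, §16.2 (pp. 333–336)] -/
noncomputable def proj : MvPolynomial (Fin m × Fin n) F →ₗ[F] Vec m n F :=
  (MvPolynomial.basisMonomials (Fin m × Fin n) F).constr F
    (fun s => if Good s.support then Finsupp.single s.support 1 else 0)

variable {m n F}

/-- `proj` of a monomial. [folklore] -/
theorem proj_monomial (s : (Fin m × Fin n) →₀ ℕ) (a : F) :
    proj m n F (monomial s a) = if Good s.support then Finsupp.single s.support a else 0 := by
  have h1 : monomial s a = a • (MvPolynomial.basisMonomials (Fin m × Fin n) F s) := by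
    rw [MvPolynomial.coe_basisMonomials, smul_monomial, smul_eq_mul, mul_one]
  rw [h1, map_smul, proj, Module.Basis.constr_basis]
  split_ifs <;> simp

/-- `proj 1 = x_∅`. [folklore] -/
theorem proj_one : proj m n F 1 = Finsupp.single ∅ 1 := by
  rw [show (1 : MvPolynomial (Fin m × Fin n) F) = monomial 0 1 from rfl, proj_monomial,
    Finsupp.support_zero, if_pos good_empty]

/-- The variables of `x_p · x^s` are `p` and those of `x^s`. [folklore] -/
theorem support_single_one_add (p : Fin m × Fin n) (s : (Fin m × Fin n) →₀ ℕ) :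
    (Finsupp.single p 1 + s).support = insert p s.support := by
  ext q
  simp only [Finsupp.mem_support_iff, Finsupp.add_apply, Finsupp.single_apply, Finset.mem_insert]
  by_cases h : p = q
  · subst h; simp
  · simp only [h, if_false, zero_add]
    constructor
    · exact fun hq => Or.inr hq
    · rintro (rfl | hq)
      · exact absurd rfl h
      · exact hq

/-- `proj` intertwines multiplication by `x_p` with the operator `x_p·` on `Ŝ` [folklore] -/
theorem proj_X_mul (p : Fin m × Fin n) (f : MvPolynomial (Fin m × Fin n) F) :
    proj m n F (X p * f) = mulVar p (proj m n F f) := by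
  induction f using MvPolynomial.induction_on' with
  | monomial s a =>
    rw [show (X p : MvPolynomial (Fin m × Fin n) F) = monomial (Finsupp.single p 1) 1 from rfl,
      monomial_mul, one_mul, proj_monomial, proj_monomial, support_single_one_add]
    split_ifs with h1 h2 h2
    · rw [mulVar_single, if_pos h1]
    · exact absurd (h1.subset (Finset.subset_insert _ _)) h2
    · rw [mulVar_single, if_neg h1]
    · rw [map_zero]
  | add f g hf hg => rw [mul_add, map_add, hf, hg, map_add, map_add]

/-- A monomial has at most as many variables as its degree. [folklore] -/
theorem card_support_le_sum (s : (Fin m × Fin n) →₀ ℕ) : s.support.card ≤ s.sum fun _ e => e := by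
  rw [Finsupp.sum, Finset.card_eq_sum_ones]
  exact Finset.sum_le_sum fun x hx => Nat.one_le_iff_ne_zero.mpr (Finsupp.mem_support_iff.mp hx)

/-- `proj` does not raise degrees: a polynomial of total degree `d` lands in `Ŝ_d` [folklore] -/
theorem proj_mem_N (f : MvPolynomial (Fin m × Fin n) F) : proj m n F f ∈ N f.totalDegree := by
  suffices h : ∀ d, f.totalDegree ≤ d → proj m n F f ∈ N d from h _ le_rfl
  intro d hd
  rw [f.as_sum, map_sum]
  refine sum_mem fun s hs => ?_
  rw [proj_monomial]
  split_ifs with hg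
  · exact single_mem_N hg (((card_support_le_sum s).trans (le_totalDegree hs)).trans hd) _
  · exact zero_mem _

variable (m n F) in
/-- the soundness invariant: `f` projects into `F · C_t`
[cite: KrajicekProofComplexity2019, §16.2, Lemma 16.2.2 (p. 334)] -/
def Inv (t : ℕ) (f : MvPolynomial (Fin m × Fin n) F) : Prop := proj m n F f ∈ W t

/-- The invariant is preserved by multiplication with a variable within the degree bound (key facts
A and B). [cite: KrajicekProofComplexity2019, §16.2, Lemma 16.2.2 (p. 334)] -/
theorem inv_X_mul {t : ℕ} (ht : 2 * t ≤ n) (a : Fin m × Fin n) {g : MvPolynomial (Fin m × Fin n) F}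
    (hg : Inv m n F t g) (hdeg : g.totalDegree + 1 ≤ t) : Inv m n F t (X a * g) := by
  obtain ⟨k, rfl⟩ : ∃ k, t = k + 1 := ⟨t - 1, by omega⟩
  unfold Inv
  rw [proj_X_mul]
  exact keyB a (keyA ht hg (N_mono (by omega) (proj_mem_N g)))

/-- The invariant is preserved by multiplication with a power of a variable within the degree
bound. [folklore] -/
theorem inv_X_pow_mul {t : ℕ} (ht : 2 * t ≤ n) (a : Fin m × Fin n) :
    ∀ (b : ℕ) {g : MvPolynomial (Fin m × Fin n) F}, Inv m n F t g → g.totalDegree + b ≤ t →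
      Inv m n F t (X a ^ b * g)
  | 0, g, hg, _ => by simpa using hg
  | b + 1, g, hg, hdeg => by
    rw [pow_succ', mul_assoc]
    refine inv_X_mul ht a (inv_X_pow_mul ht a b hg (by omega)) ?_
    have h1 := totalDegree_mul (X a ^ b) g
    have h2 := totalDegree_pow (X a : MvPolynomial (Fin m × Fin n) F) b
    have h3 : (X a : MvPolynomial (Fin m × Fin n) F).totalDegree = 1 := totalDegree_X a
    rw [h3, mul_one] at h2
    omega

/-- The invariant is preserved by multiplication with a monomial within the degree bound.
[folklore] -/
theorem inv_monomial_mul {t : ℕ} (ht : 2 * t ≤ n) (s : (Fin m × Fin n) →₀ ℕ) :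
    ∀ {g : MvPolynomial (Fin m × Fin n) F}, Inv m n F t g →
      g.totalDegree + (s.sum fun _ e => e) ≤ t → Inv m n F t (monomial s 1 * g) := by
  induction s using Finsupp.induction with
  | zero =>
    intro g hg _
    simpa using hg
  | single_add a b s ha hb ih =>
    intro g hg hdeg
    have hsum : ((Finsupp.single a b + s).sum fun _ e => e) = b + s.sum fun _ e => e := by
      rw [Finsupp.sum_add_index' (fun _ => rfl) (fun _ _ _ => rfl), Finsupp.sum_single_index rfl]
    rw [hsum] at hdeg
    rw [monomial_single_add, mul_assoc]
    refine inv_X_pow_mul ht a b (ih hg (by omega)) ?_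
    have h1 := totalDegree_mul (monomial s (1 : F)) g
    have h2 := totalDegree_monomial_le s (1 : F)
    simp only [Function.id_def] at h2
    omega

/-- the pigeon axiom has positive degree [folklore] -/
theorem one_le_totalDegree_pigeon (hn : 1 ≤ n) (i : Fin m) :
    1 ≤ (1 - ∑ j : Fin n, X (i, j) : MvPolynomial (Fin m × Fin n) F).totalDegree := by
  set j₀ : Fin n := ⟨0, hn⟩
  have hcoeff : coeff (Finsupp.single (i, j₀) 1) (1 - ∑ j : Fin n, X (i, j) :
      MvPolynomial (Fin m × Fin n) F) = -1 := by
    rw [coeff_sub, coeff_sum, coeff_one, if_neg (Ne.symm (Finsupp.single_ne_zero.mpr one_ne_zero))]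
    rw [Finset.sum_eq_single j₀]
    · rw [coeff_X_same]; ring
    · intro j _ hj
      rw [coeff_X, if_neg]
      intro he
      have := (Finsupp.single_left_inj (one_ne_zero)).mp he
      simp only [Prod.mk.injEq, true_and] at this
      exact hj this
    · intro h; exact absurd (Finset.mem_univ _) h
  have hmem : Finsupp.single (i, j₀) 1 ∈ (1 - ∑ j : Fin n, X (i, j) :
      MvPolynomial (Fin m × Fin n) F).support := by
    rw [mem_support_iff, hcoeff]; exact neg_ne_zero.mpr one_ne_zero
  have := le_totalDegree hmem
  rwa [Finsupp.sum_single_index rfl] at this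

/-- **Soundness of the invariant** (Krajíček 2019, Lemma 16.2.2, `V_t ⊆ F·C_t`): every line of a
degree-`≤ t` PC-derivation from `¬WPHP^m_n`, `2t ≤ n`, projects into `F · C_t`.
[cite: KrajicekProofComplexity2019, §16.2, Lemma 16.2.2 (p. 334)] -/
theorem inv_of_derivable {t : ℕ} (ht : 2 * t ≤ n) (hn : 1 ≤ n) {f : MvPolynomial (Fin m × Fin n) F}
    (hf : DerivableInDegree (negWPHP F m n) t f) : Inv m n F t f := by
  induction hf with
  | hyp hmem hd =>
    rcases hmem with ⟨i, rfl⟩ | ⟨i, j, j', hjj', rfl⟩ | ⟨i, i', j, hii', rfl⟩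
    · -- the pigeon axiom `Q_i`: projects to `bv (∅, {i}) ∈ C_1`
      have h1t : 1 ≤ t := (one_le_totalDegree_pigeon hn i).trans hd
      unfold Inv
      have hproj : proj m n F (1 - ∑ j : Fin n, X (i, j)) = bv (∅, {i}) := by
        rw [map_sub, map_sum, proj_one]
        have : ∀ j : Fin n, proj m n F (X (i, j)) = mulVar (i, j) (Finsupp.single ∅ 1) := by
          intro j
          rw [← mul_one (X (i, j)), proj_X_mul, proj_one]
        simp only [this]
        rw [bv, show ({i} : Finset (Fin m)) = insert i ∅ from rfl,
          bvec_insert (Finset.notMem_empty _), bvec_empty, Qop_apply]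
      rw [hproj]
      refine W_mono h1t (bv_mem_W ⟨⟨good_empty, by simp [dom], by simp, ?_⟩, ⟨i, by simp⟩⟩)
      have : pigeons (∅ : Finset (Fin m × Fin n)) = [] := by simp [pigeons, dom]
      simp only [this]
      trivial
    · unfold Inv
      rw [← mul_one (X (i, j) * X (i, j')), mul_assoc, proj_X_mul, proj_X_mul,
        ← Module.End.mul_apply,
        mulVar_mul_eq_zero (p := (i, j)) (q := (i, j')) (by simpa using hjj') (Or.inl rfl),
        LinearMap.zero_apply]
      exact zero_mem _
    · unfold Inv
      rw [← mul_one (X (i, j) * X (i', j)), mul_assoc, proj_X_mul, proj_X_mul,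
        ← Module.End.mul_apply,
        mulVar_mul_eq_zero (p := (i, j)) (q := (i', j)) (by simpa using hii') (Or.inr rfl),
        LinearMap.zero_apply]
      exact zero_mem _
  | booleanAxiom p hd =>
    unfold Inv
    rw [map_sub, pow_two, ← mul_one (X p * X p), mul_assoc, proj_X_mul, proj_X_mul, ← mul_one (X p),
      proj_X_mul, ← Module.End.mul_apply, mulVar_mul_self, sub_self]
    exact zero_mem _
  | add _ _ ihf ihg =>
    unfold Inv at *
    rw [map_add]
    exact add_mem ihf ihg
  | @mul f h _ hd ih =>
    by_cases hf0 : f = 0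
    · unfold Inv; rw [hf0, zero_mul, map_zero]; exact zero_mem _
    by_cases hh0 : h = 0
    · unfold Inv; rw [hh0, mul_zero, map_zero]; exact zero_mem _
    have hdeg : f.totalDegree + h.totalDegree ≤ t := by
      rw [← totalDegree_mul_of_isDomain hf0 hh0]; exact hd
    unfold Inv
    rw [h.as_sum, Finset.mul_sum, map_sum]
    refine sum_mem fun s hs => ?_
    have : f * monomial s (coeff s h) = coeff s h • (monomial s 1 * f) := by
      rw [mul_comm, ← smul_mul_assoc, smul_monomial, smul_eq_mul, mul_one]
    rw [this, map_smul]
    refine Submodule.smul_mem _ _ (inv_monomial_mul ht s ih ?_)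
    exact (Nat.add_le_add_left (le_totalDegree hs) _).trans hdeg

/-- **Theorem 16.2.1** for one field: no PC/F-refutation of `¬WPHP^m_n` of degree `≤ n/2`.
[cite: KrajicekProofComplexity2019, Thm 16.2.1] -/
theorem not_refutable (hn : 1 ≤ n) : ¬ RefutableInDegree (negWPHP F m n) (n / 2) := by
  intro h
  have hinv := inv_of_derivable (F := F) (t := n / 2) (by omega) hn h
  unfold Inv at hinv
  rw [proj_one] at hinv
  exact single_empty_notMem_W (F := F) (k := n / 2) (by omega) hinv

end PCsound

end RazborovDance

/-- **Razborov's theorem (Krajíček 2019, Thm. 16.2.1) holds**: for every field `F` and all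
`m > n ≥ 1` there is no PC/F-refutation of `¬WPHP^m_n` of degree `≤ n/2`. Discharges the named
fact `Razborov1998_PC_negWPHP_degree`; the proof is Krajíček's (Lemma 16.2.2 with Claims 1–3,
following Razborov 1998 and Impagliazzo–Pudlák–Sgall 1999), formalised in the namespace
`RazborovDance` above. [cite: KrajicekProofComplexity2019, Thm 16.2.1] -/
theorem Razborov1998_PC_negWPHP_degree_holds : Razborov1998_PC_negWPHP_degree :=
  fun F _ _ _ _ hn => RazborovDance.not_refutable (F := F) hn

end PC
end Literature.Computability.MetaComplexity
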